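import Mathlib.LinearAlgebra.Matrix.Rank
import Mathlib.LinearAlgebra.Matrix.NonsingularInverse
import Mathlib.Data.Matrix.Block
import Mathlib.Data.Fintype.Powerset
import Mathlib.GroupTheory.Perm.Fin
import Mathlib.LinearAlgebra.Vandermonde
import Mathlib.LinearAlgebra.Matrix.Nondegenerate
import Mathlib.Algebra.MvPolynomial.Funext
import Mathlib.LinearAlgebra.Basis.VectorSpace
import Mathlib.Tactic.FinCases
import Mathlib.Tactic.FieldSimp
import Mathlib.Tactic.Linarith
import Mathlib.Tactic.Positivity
import Literature.Computability.AlgebraicComplexity.MatMulRankLowerBounds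
import Literature.Computability.AlgebraicComplexity.FlatteningBound
import Literature.Computability.AlgebraicComplexity.RankMethodBarriers
import HarnessLib

/-!
# Koszul flattenings and Landsberg's rank lower bound for matrix multiplication (proofs)

Topic: `Literature/Computability/AlgebraicComplexity`. Sibling proof file of
`MatMulRankLowerBounds.lean`: it discharges the named fact `Literature.Computability.AlgebraicComplexity.Landsberg2014_thm_1_2`,
`R(⟨n,n,n⟩) ≥ (3 − 1/(p+1)) n² − (1 + 2p binom(2p,p−1)) n` over `ℂ` for `1 ≤ p ≤ n − 1`
(Landsberg 2014, Thm 1.2), as `Landsberg2014_thm_1_2_holds`, sorry-free, together with the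
Koszul-flattening machinery of Landsberg–Ottaviani it rests on.  Everything here is **proved**.

## Content

* `PSub q k`, `koszulSign`, `wedgeMatrix e` — exterior algebra of `K^q` in coordinates: the matrix
  of `e ∧ ·` on the basis `e_S`, `S ⊆ Fin q` (all degrees at once); `wedgeMatrix_mul_self`
  (`e ∧ e ∧ · = 0`), `rank_wedgeBlock_le` (`rank(e ∧ · : Λ^p → Λ^{p+1}) ≤ binom(2p,p)` on `K^{2p+1}`).
* `koszulFlattening p Φ t` — the Koszul flattening
  `((Φ ⊗ 1 ⊗ 1)t)_E^{∧p} : Λ^p E ⊗ B^* → Λ^{p+1} E ⊗ C`, `E = K^{2p+1}`, of a coordinate tensor `t`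
  after a linear map `Φ` on the first factor (LO2015 §2, GCT (2.4.5)–(2.4.6)), as a matrix;
  `matMulKoszulMatrix n p Φ` — Landsberg's reduced map `M̃^{∧p}_{A'}` for `⟨n, m, n⟩` (the Koszul
  flattening of matrix multiplication is `M̃ ⊗ Id_m`, Landsberg 2014 §3;
  `koszulFlattening_matMul_submatrix`).
* `LandsbergOttaviani2015_rank_koszulFlattening_le` — **LO2015 Thm 2.1** in rank form:
  `rank K_Φ(t) ≤ binom(2p,p) R(t)`.
* `vandermondeProj p`, `matMulKoszulMatrix_vandermondeProj_injective` — the LO2015 §3 projection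
  `S^pW^* ⊗ S^pW^* → S^{2p}W^*` (GCT (2.5.2): `u^i ⊗ v_j ↦ e_{i+j−1}`) written in the Lagrange basis
  of `S^{2p}W^*` at the nodes `0,…,2p` (`e_{κν} ↦ (i^{κ+ν})_i`), and the **non-degeneracy of `M̃` for
  `⟨p+1, ·, p+1⟩`** (LO2015 §3 / GCT Thm 2.5.2.6), proved by a two-step Vandermonde argument.
* `commutatorProj n`, `matMulKoszulMatrix_commutatorProj_injective` — the case `p = 1` of
  Landsberg 2014 §4 (`X₀ = Id`, determinant `= det[X₁, X₂]`): with `X₁ =` cyclic shift and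
  `X₂ = diag(0,…,n−1)`, `M̃` is injective for `n ≥ 2` (char. 0).
* `blockProj`, `det_blocks_ne_zero` — block-diagonal projections from `n/(p+1)` copies of `Φ₀` and
  the resulting non-zero minor of size `(n − n mod (p+1)) binom(2p+1,p)`.
* `Landsberg2014_lemma_2_2` — **Lemma 2.2** (a non-zero polynomial of degree `d` stays non-zero on
  the span of `≤ d` basis vectors: pick a monomial); `Landsberg2014_prop_2_1_koszul` — **Prop 2.1 +
  Lemma 2.2 + §3**: a non-zero `ρ`-minor of `M̃(Φ)` gives `m ρ + binom(2p,p) n² ≤ binom(2p,p)(ρ + R(⟨n,m,n⟩))`.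
* `Landsberg2014_thm_1_2_holds : Landsberg2014_thm_1_2`.

## On the printed proof and the error term

Landsberg's §3 gives `R(⟨n,n,m⟩) ≥ (2p+1)nm/(p+1) + n² − (2p+1) binom(2p+1,p) n` from Prop 2.1,
Lemma 2.3 (polynomials on Grassmannians) and the LO2015 non-degeneracy; §4 improves the error term
to `(1 + 2p binom(2p,p−1)) n` by a normal-form computation, and Thm 1.2 is the case `m = n`.  The
route formalised here applies Lemma 2.2 once, to a maximal non-zero minor of `M̃(Φ)` regarded as a
polynomial (of degree `ρ`) in the images `Φ(a_i)` of a basis `(a_i)_{i∈I}` extracted from an optimal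
decomposition (`Landsberg2014_prop_2_1_koszul`); this loses only `ρ ≤ binom(2p+1,p) n`, and
`binom(2p+1,p) ≤ 1 + 2p binom(2p,p−1)` for `p ≥ 1`.  With the block-diagonal `Φ` the minor has size
`(n − n mod (p+1)) binom(2p+1,p)` and the slack absorbs the remainder for `p ≥ 2`; for `p = 1` the
commutator projection gives the full `3n`.  The statement proved is exactly Thm 1.2 as vendored
(nothing weakened); the non-degeneracy is proved for the Vandermonde (Lagrange-basis) form of the
LO2015 projection rather than by the orderings of GCT pp. 47–48.

## Mathlib

Uses `Matrix.rank` (`rank_mul_le_left/right`, `rank_submatrix_le`, `rank_of_isUnit`),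
`LinearMap.finrank_range_add_finrank_ker`, `Matrix.det_blockDiagonal`,
`Matrix.mulVec_injective_iff_isUnit`, `Matrix.vandermonde` / `det_vandermonde_ne_zero_iff` /
`eq_zero_of_mulVec_eq_zero`, `exists_linearIndependent'`, `Module.Basis.mk` / `constr`,
`MvPolynomial.funext`, `MvPolynomial.totalDegree_*`, `RingHom.map_det`, `Finset.sum_ninvolution`,
`support_finRotate_of_le`.  Mathlib has exterior powers (`⋀[R]^n M`) but no coordinate bases /
Koszul maps usable for rank counts, hence the coordinate `wedgeMatrix`.

## References

* J. M. Landsberg, *New lower bounds for the rank of matrix multiplication*, SIAM J. Comput. 43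
  (2014) 144–149, arXiv:1206.1530v2: Thm 1.1, Thm 1.2 (p.1), Prop 2.1, Lemma 2.2, Lemma 2.3 (§2),
  §3 (the reduced map `M̃^{∧p}_{A'}`), §4 (case `p = 1`, commutators). [Landsberg2014]
* J. M. Landsberg, G. Ottaviani, *New lower bounds for the border rank of matrix multiplication*,
  Theory of Computing 11 (2015) 285–298, arXiv:1112.6007: Thm 2.1 and its proof (§2), §3 (the
  projection `M ⊗ U → S^{m+n−2}W^*` and injectivity of `ψ'_p`). [LandsbergOttaviani2015]
* J. M. Landsberg, *Geometry and Complexity Theory*, CUP 2017: §2.4.2 ((2.4.5), (2.4.6),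
  Prop 2.4.2.1), §2.5.2 ((2.5.2), Thm 2.5.2.6), §2.6 (Thm 2.6.1.2). [LandsbergGCT2017]
* M. Bläser, *Fast Matrix Multiplication*, Theory of Computing Graduate Surveys 5 (2013), §5
  (the tensor `⟨k,m,n⟩`). [Blaser2013]
-/

noncomputable section

open scoped BigOperators
open Matrix

namespace Literature.Computability.AlgebraicComplexity

/-! ## Exterior powers of `K^q` in coordinates -/

/-- The index set of the standard basis of `Λ^k K^q`: the `k`-element subsets
`S = {s₁ < ⋯ < s_k}` of `Fin q`, standing for `e_S = e_{s₁} ∧ ⋯ ∧ e_{s_k}`. [folklore] -/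
abbrev PSub (q k : ℕ) : Type := {S : Finset (Fin q) // S.card = k}

/-- `|PSub q k| = binom(q, k)` (`= dim Λ^k K^q`). [folklore] -/
theorem card_PSub (q k : ℕ) : Fintype.card (PSub q k) = q.choose k := by
  rw [Fintype.card_finset_len, Fintype.card_fin]

/-- The Koszul sign `ε(S, j) = (−1)^{#{s ∈ S | s < j}}`: for `j ∉ S`,
`e_j ∧ e_S = ε(S, j) · e_{S ∪ {j}}` (move `e_j` past the elements of `S` below `j`). [folklore] -/
def koszulSign {q : ℕ} (S : Finset (Fin q)) (j : Fin q) : ℤ :=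
  (-1) ^ (S.filter (· < j)).card

/-- `ε(S, j)² = 1`. [folklore] -/
theorem koszulSign_mul_self {q : ℕ} (S : Finset (Fin q)) (j : Fin q) :
    koszulSign S j * koszulSign S j = 1 := by
  unfold koszulSign
  rw [← pow_add, ← two_mul, pow_mul]
  simp

section Wedge

variable {K : Type*} [CommRing K] {q : ℕ}

/-- The matrix of left exterior multiplication `e ∧ · : Λ^• K^q → Λ^• K^q` by
`e = ∑_j e_j f_j ∈ K^q`, in the basis `(e_S)_{S ⊆ Fin q}` (all degrees at once): the entry in
row `T`, column `S` is `ε(S, j) e_j` if `T = S ∪ {j}` with `j ∉ S`, and `0` otherwise, i.e.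
`e ∧ e_S = ∑_{j ∉ S} ε(S, j) e_j e_{S ∪ {j}}`. [folklore] -/
def wedgeMatrix (e : Fin q → K) : Matrix (Finset (Fin q)) (Finset (Fin q)) K :=
  Matrix.of fun T S => ∑ j, if j ∉ S ∧ T = insert j S then (koszulSign S j : K) * e j else 0

/-- Unfolding lemma for `wedgeMatrix`. [folklore] -/
theorem wedgeMatrix_apply (e : Fin q → K) (T S : Finset (Fin q)) :
    wedgeMatrix e T S =
      ∑ j, if j ∉ S ∧ T = insert j S then (koszulSign S j : K) * e j else 0 := rfl

/-- `e ↦ (e ∧ ·)` is additive. [folklore] -/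
theorem wedgeMatrix_add (e e' : Fin q → K) :
    wedgeMatrix (e + e') = wedgeMatrix e + wedgeMatrix e' := by
  ext T S
  simp only [wedgeMatrix_apply, Matrix.add_apply, ← Finset.sum_add_distrib]
  refine Finset.sum_congr rfl fun j _ => ?_
  split_ifs <;> simp [mul_add]

/-- `e ↦ (e ∧ ·)` is homogeneous. [folklore] -/
theorem wedgeMatrix_smul (c : K) (e : Fin q → K) :
    wedgeMatrix (c • e) = c • wedgeMatrix e := by
  ext T S
  simp only [wedgeMatrix_apply, Matrix.smul_apply, smul_eq_mul, Finset.mul_sum]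
  refine Finset.sum_congr rfl fun j _ => ?_
  split_ifs <;> simp [Pi.smul_apply, mul_left_comm]

/-- `0 ∧ · = 0`. [folklore] -/
@[simp] theorem wedgeMatrix_zero : wedgeMatrix (0 : Fin q → K) = 0 := by
  ext T S
  simp [wedgeMatrix_apply]

/-- `wedgeMatrix` bundled as a `K`-linear map `K^q → Mat`. [folklore] -/
def wedgeMatrixLin : (Fin q → K) →ₗ[K] Matrix (Finset (Fin q)) (Finset (Fin q)) K where
  toFun := wedgeMatrix
  map_add' := wedgeMatrix_add
  map_smul' := wedgeMatrix_smul

/-- Unfolding lemma for `wedgeMatrixLin`. [folklore] -/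
@[simp] theorem wedgeMatrixLin_apply (e : Fin q → K) : wedgeMatrixLin e = wedgeMatrix e := rfl

/-- The entry `(S ∪ {j}, S)` of `e ∧ ·` is `ε(S, j) e_j` (`j ∉ S`). [folklore] -/
theorem wedgeMatrix_insert (e : Fin q → K) {S : Finset (Fin q)} {j : Fin q} (hj : j ∉ S) :
    wedgeMatrix e (insert j S) S = (koszulSign S j : K) * e j := by
  rw [wedgeMatrix_apply, Finset.sum_eq_single j]
  · rw [if_pos ⟨hj, rfl⟩]
  · intro i _ hij
    rw [if_neg]
    rintro ⟨hi, h⟩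
    have : i ∈ insert j S := h ▸ Finset.mem_insert_self i S
    rcases Finset.mem_insert.1 this with h' | h'
    · exact hij h'
    · exact hi h'
  · simp

/-- Entries of `e ∧ ·` outside the pattern `(S ∪ {j}, S)` vanish. [folklore] -/
theorem wedgeMatrix_of_not (e : Fin q → K) {T S : Finset (Fin q)}
    (h : ¬ (S ⊆ T ∧ T.card = S.card + 1)) : wedgeMatrix e T S = 0 := by
  rw [wedgeMatrix_apply]
  refine Finset.sum_eq_zero fun j _ => ?_
  rw [if_neg]
  rintro ⟨hj, rfl⟩
  exact h ⟨Finset.subset_insert j S, Finset.card_insert_of_notMem hj⟩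

/-- Reindexing the defining sum of `(e ∧ ·)|_{Λ^p}` over the rows: for `|T| = p + 1`,
`∑_{|S| = p} ∑_j [j ∉ S, T = S ∪ {j}] g(S, j) = ∑_{j ∈ T} g(T ∖ {j}, j)`. [folklore] -/
theorem sum_PSub_wedge {M : Type*} [AddCommMonoid M] {p : ℕ} (T : PSub q (p + 1))
    (g : Finset (Fin q) → Fin q → M) :
    ∑ S : PSub q p, ∑ j, (if j ∉ S.1 ∧ T.1 = insert j S.1 then g S.1 j else 0) =
      ∑ j ∈ T.1, g (T.1.erase j) j := by
  rw [Finset.sum_comm]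
  have h0 : ∀ j ∈ (Finset.univ : Finset (Fin q)), j ∉ T.1 →
      (∑ S : PSub q p, if j ∉ S.1 ∧ T.1 = insert j S.1 then g S.1 j else 0) = 0 := by
    intro j _ hj
    refine Finset.sum_eq_zero fun S _ => ?_
    rw [if_neg]
    rintro ⟨-, hT⟩
    exact hj (hT ▸ Finset.mem_insert_self j S.1)
  rw [← Finset.sum_subset (Finset.subset_univ T.1) h0]
  refine Finset.sum_congr rfl fun j hj => ?_
  have hcard : (T.1.erase j).card = p := by
    rw [Finset.card_erase_of_mem hj, T.2]; rfl
  rw [Fintype.sum_eq_single (⟨T.1.erase j, hcard⟩ : PSub q p)]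
  · rw [if_pos ⟨Finset.notMem_erase j T.1, (Finset.insert_erase hj).symm⟩]
  · intro S hS
    rw [if_neg]
    rintro ⟨hjS, hT⟩
    apply hS
    apply Subtype.ext
    simp [hT, Finset.erase_insert hjS]

/-- Extension by zero of a vector on `PSub q k × α` to all subsets of `Fin q` (a bookkeeping
device avoiding membership proofs inside sums). [folklore] -/
def extendPSub {k : ℕ} {α : Type*} (z : PSub q k × α → K) (S : Finset (Fin q)) (a : α) : K :=
  if h : S.card = k then z (⟨S, h⟩, a) else 0

/-- On `k`-subsets the extension by zero is the original vector. [folklore] -/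
@[simp] theorem extendPSub_val {k : ℕ} {α : Type*} (z : PSub q k × α → K) (S : PSub q k)
    (a : α) : extendPSub z S.1 a = z (S, a) := by
  simp [extendPSub, S.2]

/-- `extendPSub` on a subset of the right size. [folklore] -/
theorem extendPSub_of_card {k : ℕ} {α : Type*} (z : PSub q k × α → K) {S : Finset (Fin q)}
    (h : S.card = k) (a : α) : extendPSub z S a = z (⟨S, h⟩, a) := by
  simp [extendPSub, h]

end Wedge

/-! ## Koszul flattenings -/

section Koszul

variable {K : Type*} [CommRing K]

/-- The **Koszul flattening** of a tensor `t ∈ K^ι ⊗ K^κ ⊗ K^μ` after a linear map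
`Φ : K^ι → E = K^{2p+1}` on the first factor (Landsberg–Ottaviani; GCT (2.4.5)–(2.4.6)): the
matrix of `((Φ ⊗ 1 ⊗ 1) t)_E^{∧p} : Λ^p E ⊗ (K^κ)^* → Λ^{p+1} E ⊗ K^μ`,
`e_S ⊗ b^* ↦ ∑_{a, c} t_{abc} (Φ e_a ∧ e_S) ⊗ e_c`; rows `(T, c)` with `|T| = p + 1`, columns
`(S, b)` with `|S| = p`, entry `(Φ(t(·, b, c)) ∧ e_S)_T`.
[cite: LandsbergGCT2017, §2.4.2 (2.4.5)-(2.4.6)] [cite: LandsbergOttaviani2015, §2 (T_A^{∧p})] -/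
def koszulFlattening (p : ℕ) {ι κ μ : Type*} (Φ : (ι → K) →ₗ[K] (Fin (2 * p + 1) → K))
    (t : ι → κ → μ → K) :
    Matrix (PSub (2 * p + 1) (p + 1) × μ) (PSub (2 * p + 1) p × κ) K :=
  Matrix.of fun r c => wedgeMatrix (Φ fun a => t a c.2 r.2) r.1.1 c.1.1

/-- Unfolding lemma for `koszulFlattening`. [cite: LandsbergGCT2017, §2.4.2 (2.4.6)] -/
theorem koszulFlattening_apply (p : ℕ) {ι κ μ : Type*}
    (Φ : (ι → K) →ₗ[K] (Fin (2 * p + 1) → K)) (t : ι → κ → μ → K)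
    (r : PSub (2 * p + 1) (p + 1) × μ) (c : PSub (2 * p + 1) p × κ) :
    koszulFlattening p Φ t r c = wedgeMatrix (Φ fun a => t a c.2 r.2) r.1.1 c.1.1 := rfl

/-- `t ↦ K_Φ(t)` is additive. [cite: LandsbergGCT2017, §2.4.2 ("By linearity of the map T ↦ T_A^{∧p}")] -/
theorem koszulFlattening_add (p : ℕ) {ι κ μ : Type*}
    (Φ : (ι → K) →ₗ[K] (Fin (2 * p + 1) → K)) (t t' : ι → κ → μ → K) :
    koszulFlattening p Φ (t + t') = koszulFlattening p Φ t + koszulFlattening p Φ t' := by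
  ext r c
  simp only [koszulFlattening_apply, Matrix.add_apply]
  rw [← Matrix.add_apply (wedgeMatrix _) (wedgeMatrix _), ← wedgeMatrix_add, ← map_add]
  rfl

/-- `K_Φ(0) = 0`. [cite: LandsbergGCT2017, §2.4.2 ("By linearity of the map T ↦ T_A^{∧p}")] -/
@[simp] theorem koszulFlattening_zero (p : ℕ) {ι κ μ : Type*}
    (Φ : (ι → K) →ₗ[K] (Fin (2 * p + 1) → K)) :
    koszulFlattening p Φ (0 : ι → κ → μ → K) = 0 := by
  ext r c
  simp only [koszulFlattening_apply, Matrix.zero_apply]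
  rw [show (fun a : ι => (0 : ι → κ → μ → K) a c.2 r.2) = 0 from rfl, map_zero, wedgeMatrix_zero]
  rfl

/-- `t ↦ K_Φ(t)` commutes with finite sums. [cite: LandsbergGCT2017, §2.4.2 ("By linearity of the map T ↦ T_A^{∧p}")] -/
theorem koszulFlattening_sum (p : ℕ) {ι κ μ σ : Type*}
    (Φ : (ι → K) →ₗ[K] (Fin (2 * p + 1) → K)) (s : Finset σ) (t : σ → ι → κ → μ → K) :
    koszulFlattening p Φ (∑ i ∈ s, t i) = ∑ i ∈ s, koszulFlattening p Φ (t i) := by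
  classical
  induction s using Finset.induction_on with
  | empty => simp
  | insert a s ha ih => rw [Finset.sum_insert ha, Finset.sum_insert ha, koszulFlattening_add, ih]

/-- The **reduced Koszul flattening of matrix multiplication** `M̃_E^{∧p}` (Landsberg 2014, §3,
(estar); GCT §2.5.2, `ψ_p`): for `Φ : K^{n×n} → E = K^{2p+1}`, the matrix with rows `(T, ν)`
(`|T| = p+1`, `ν < n`), columns `(S, κ)` (`|S| = p`, `κ < n`) and entry `(Φ(e_{κν}) ∧ e_S)_T`. The
Koszul flattening of `⟨n, m, n⟩` (first factor `K^{n×n} ∋ e_{κν}`) after `Φ` is this matrix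
tensored with the identity of `K^m`. [cite: Landsberg2014, §3 (the reduced map M̃^{∧p}_{A'})]
[cite: LandsbergGCT2017, §2.5.2 (ψ_p)] -/
def matMulKoszulMatrix (n p : ℕ) (Φ : (Fin n × Fin n → K) →ₗ[K] (Fin (2 * p + 1) → K)) :
    Matrix (PSub (2 * p + 1) (p + 1) × Fin n) (PSub (2 * p + 1) p × Fin n) K :=
  Matrix.of fun r c => wedgeMatrix (Φ (Pi.single (c.2, r.2) 1)) r.1.1 c.1.1

/-- Unfolding lemma for `matMulKoszulMatrix`. [cite: Landsberg2014, §3 (the reduced map M̃^{∧p}_{A'})] -/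
theorem matMulKoszulMatrix_apply (n p : ℕ) (Φ : (Fin n × Fin n → K) →ₗ[K] (Fin (2 * p + 1) → K))
    (r : PSub (2 * p + 1) (p + 1) × Fin n) (c : PSub (2 * p + 1) p × Fin n) :
    matMulKoszulMatrix n p Φ r c = wedgeMatrix (Φ (Pi.single (c.2, r.2) 1)) r.1.1 c.1.1 := rfl

/-- Row `(T, ν)` of `M̃(Φ) z`: `∑_{j ∈ T} ε(T∖j, j) ∑_κ Φ(e_{κν})_j z_{(T∖j, κ)}`.
[cite: LandsbergGCT2017, §2.4.2 (2.4.6)] -/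
theorem matMulKoszulMatrix_mulVec (n p : ℕ) (Φ : (Fin n × Fin n → K) →ₗ[K] (Fin (2 * p + 1) → K))
    (z : PSub (2 * p + 1) p × Fin n → K) (T : PSub (2 * p + 1) (p + 1)) (ν : Fin n) :
    (matMulKoszulMatrix n p Φ *ᵥ z) (T, ν) =
      ∑ j ∈ T.1, (koszulSign (T.1.erase j) j : K) *
        ∑ κ, Φ (Pi.single (κ, ν) 1) j * extendPSub z (T.1.erase j) κ := by
  rw [Matrix.mulVec, dotProduct, Fintype.sum_prod_type]
  simp only [matMulKoszulMatrix_apply, wedgeMatrix_apply, Finset.sum_mul]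
  have : ∀ S : PSub (2 * p + 1) p,
      (∑ κ, ∑ j, (if j ∉ S.1 ∧ T.1 = insert j S.1
        then (koszulSign S.1 j : K) * Φ (Pi.single (κ, ν) 1) j else 0) * z (S, κ)) =
      ∑ j, (if j ∉ S.1 ∧ T.1 = insert j S.1 then
        (koszulSign S.1 j : K) * ∑ κ, Φ (Pi.single (κ, ν) 1) j * extendPSub z S.1 κ else 0) := by
    intro S
    rw [Finset.sum_comm]
    refine Finset.sum_congr rfl fun j _ => ?_
    split_ifs with h
    · rw [Finset.mul_sum]
      refine Finset.sum_congr rfl fun κ _ => ?_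
      rw [extendPSub_val]; ring
    · simp
  simp only [this]
  exact sum_PSub_wedge T (fun S j => (koszulSign S j : K) *
    ∑ κ, Φ (Pi.single (κ, ν) 1) j * extendPSub z S κ)

end Koszul



/-! ## Landsberg–Ottaviani: `rank K_Φ(t) ≤ binom(2p,p) R(t)` -/

-- `matrix_rank_add_le` / `matrix_rank_sum_le` (sub-additivity of matrix rank) are imported from
-- `RankMethodBarriers.lean`.

section WedgeSquare

variable {K : Type*} [CommRing K] {q : ℕ}

/-- Inserting an element below `j` flips the Koszul sign at `j`. [folklore] -/
theorem koszulSign_insert_of_lt {R : Finset (Fin q)} {i j : Fin q} (hi : i ∉ R) (hij : i < j) :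
    koszulSign (insert i R) j = -koszulSign R j := by
  unfold koszulSign
  rw [Finset.filter_insert, if_pos hij, Finset.card_insert_of_notMem (by simp [hi]), pow_succ]
  ring

/-- Inserting an element above `j` does not change the Koszul sign at `j`. [folklore] -/
theorem koszulSign_insert_of_gt {R : Finset (Fin q)} {i j : Fin q} (hij : j < i) :
    koszulSign (insert i R) j = koszulSign R j := by
  unfold koszulSign
  rw [Finset.filter_insert, if_neg (not_lt.2 hij.le)]

/-- **`e ∧ e ∧ x = 0`**: the square of left exterior multiplication vanishes (the sign
cancellation `ε(R ∪ i, j) ε(R, i) + ε(R ∪ j, i) ε(R, j) = 0`). [folklore] -/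
theorem wedgeMatrix_mul_self (e : Fin q → K) : wedgeMatrix e * wedgeMatrix e = 0 := by
  ext T R
  rw [Matrix.mul_apply, Matrix.zero_apply]
  -- the summand as a function of the pair `(i, j)` of inserted indices
  set F : Fin q → Fin q → K := fun i j =>
    if i ∉ R ∧ j ∉ insert i R ∧ T = insert j (insert i R) then
      (koszulSign (insert i R) j : K) * e j * ((koszulSign R i : K) * e i) else 0 with hF
  have step1 : ∀ S, wedgeMatrix e T S * wedgeMatrix e S R =
      ∑ i, if i ∉ R ∧ S = insert i R then wedgeMatrix e T S * ((koszulSign R i : K) * e i)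
        else 0 := by
    intro S
    rw [wedgeMatrix_apply e S R, Finset.mul_sum]
    refine Finset.sum_congr rfl fun i _ => ?_
    split_ifs <;> simp
  simp_rw [step1]
  rw [Finset.sum_comm]
  have step2 : ∀ i, (∑ S, if i ∉ R ∧ S = insert i R then
      wedgeMatrix e T S * ((koszulSign R i : K) * e i) else 0) = ∑ j, F i j := by
    intro i
    by_cases hi : i ∉ R
    · simp only [hi, not_false_eq_true, true_and]
      rw [Finset.sum_ite_eq' Finset.univ (insert i R), if_pos (Finset.mem_univ _),
        wedgeMatrix_apply, Finset.sum_mul]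
      refine Finset.sum_congr rfl fun j _ => ?_
      simp only [hF, hi, not_false_eq_true, true_and]
      split_ifs <;> ring
    · have h0 : ∀ j, F i j = 0 := fun j => by simp only [hF]; rw [if_neg]; exact fun h => hi h.1
      simp [hi, h0]
  simp_rw [step2]
  -- antisymmetry of `F`
  have anti_lt : ∀ i j, i < j → F i j + F j i = 0 := by
    intro i j hij
    by_cases hc : i ∉ R ∧ j ∉ insert i R ∧ T = insert j (insert i R)
    · obtain ⟨hi, hj, hT⟩ := hc
      have hj' : j ∉ R := fun h => hj (Finset.mem_insert_of_mem h)
      have hi' : i ∉ insert j R := by simp [hi, hij.ne]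
      have hT' : T = insert i (insert j R) := by rw [hT, Finset.insert_comm]
      simp only [hF]
      rw [if_pos (And.intro hi (And.intro hj hT)), if_pos (And.intro hj' (And.intro hi' hT')),
        koszulSign_insert_of_lt hi hij, koszulSign_insert_of_gt hij]
      push_cast
      ring
    · have hc' : ¬ (j ∉ R ∧ i ∉ insert j R ∧ T = insert i (insert j R)) := by
        rintro ⟨hj, hi, hT⟩
        exact hc ⟨fun h => hi (Finset.mem_insert_of_mem h), by simp [hj, hij.ne'],
          by rw [hT, Finset.insert_comm]⟩
      simp only [hF, if_neg hc, if_neg hc', add_zero]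
  have anti : ∀ i j, F i j + F j i = 0 := by
    intro i j
    rcases lt_trichotomy i j with hij | rfl | hij
    · exact anti_lt i j hij
    · have : ¬ (i ∉ R ∧ i ∉ insert i R ∧ T = insert i (insert i R)) :=
        fun h => h.2.1 (Finset.mem_insert_self i R)
      simp only [hF, if_neg this, add_zero]
    · rw [add_comm]; exact anti_lt j i hij
  rw [← Fintype.sum_prod_type']
  refine Finset.sum_ninvolution (fun x : Fin q × Fin q => x.swap) (fun x => anti x.1 x.2)
    (fun x hx h => ?_) (fun _ => Finset.mem_univ _) (fun x => Prod.swap_swap x)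
  -- a non-zero term is off-diagonal
  apply hx
  have hxx : x.1 = x.2 := by
    have := congrArg Prod.fst h
    simpa using this.symm
  have := anti x.1 x.2
  rw [← hxx] at this ⊢
  -- F a a + F a a = 0 with F a a = 0
  have h0 : ¬ (x.1 ∉ R ∧ x.1 ∉ insert x.1 R ∧ T = insert x.1 (insert x.1 R)) :=
    fun h => h.2.1 (Finset.mem_insert_self _ R)
  simp only [hF, if_neg h0]

end WedgeSquare

section WedgeRank

variable {L : Type*} [Field L]

/-- The graded piece `Λ^p → Λ^{p+1}` of `e ∧ ·` on `L^{2p+1}`, as a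
`PSub (2p+1) (p+1) × PSub (2p+1) p` matrix. [folklore] -/
def wedgeBlock (p : ℕ) (e : Fin (2 * p + 1) → L) :
    Matrix (PSub (2 * p + 1) (p + 1)) (PSub (2 * p + 1) p) L :=
  (wedgeMatrix e).submatrix (fun T => T.1) (fun S => S.1)

/-- **`rank (e ∧ · : Λ^p L^{2p+1} → Λ^{p+1} L^{2p+1}) ≤ binom(2p, p)`** (with equality for `e ≠ 0`,
not needed): for `e_{j₀} ≠ 0` the `binom(2p, p−1)` vectors `e ∧ e_R`, `j₀ ∉ R`, `|R| = p − 1`, are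
independent (look at the coefficient of `e_{R ∪ j₀}`) and lie in the kernel (`e ∧ e = 0`), and
`binom(2p+1, p) − binom(2p, p−1) = binom(2p, p)`. This is the rank-one computation
"the image is `a ∧ Λ^p A ⊗ c`" of LO2015 / GCT §2.4.2. [cite: LandsbergOttaviani2015, §2 (rank of (a⊗b⊗c)_A^{∧p})]
[cite: LandsbergGCT2017, §2.4.2 (before Prop 2.4.2.1)] -/
theorem rank_wedgeBlock_le (p : ℕ) (e : Fin (2 * p + 1) → L) :
    (wedgeBlock p e).rank ≤ (2 * p).choose p := by
  classical
  by_cases he : e = 0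
  · subst he
    have : wedgeBlock p (0 : Fin (2 * p + 1) → L) = 0 := by
      ext T S; simp [wedgeBlock]
    rw [this, Matrix.rank_zero]
    exact Nat.zero_le _
  rcases Nat.eq_zero_or_pos p with rfl | hp
  · refine (Matrix.rank_le_card_width _).trans ?_
    simp
  obtain ⟨p', rfl⟩ : ∃ p', p = p' + 1 := ⟨p - 1, by omega⟩
  obtain ⟨j0, hj0⟩ : ∃ j0, e j0 ≠ 0 := by
    by_contra h
    push Not at h
    exact he (funext h)
  -- the kernel vectors `e ∧ e_R`, `R = emb(R')`, `|R'| = p'`, `emb` omitting `j0`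
  have hj0R : ∀ R' : PSub (2 * (p' + 1)) p', j0 ∉ R'.1.map (Fin.succAboveEmb j0) := by
    intro R' h
    obtain ⟨y, _, hy⟩ := Finset.mem_map.1 h
    exact Fin.succAbove_ne j0 y hy
  have hcardR : ∀ R' : PSub (2 * (p' + 1)) p', (R'.1.map (Fin.succAboveEmb j0)).card = p' :=
    fun R' => by rw [Finset.card_map, R'.2]
  -- (i) they lie in the kernel
  have hker : ∀ R' : PSub (2 * (p' + 1)) p',
      wedgeBlock (p' + 1) e *ᵥ
        (fun S : PSub (2 * (p' + 1) + 1) (p' + 1) =>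
          wedgeMatrix e S.1 (R'.1.map (Fin.succAboveEmb j0))) = 0 := by
    intro R'
    funext T
    rw [Matrix.mulVec, dotProduct, Pi.zero_apply]
    have full : ∑ S : Finset (Fin (2 * (p' + 1) + 1)),
        wedgeMatrix e T.1 S * wedgeMatrix e S (R'.1.map (Fin.succAboveEmb j0)) = 0 := by
      have := congrFun (congrFun (wedgeMatrix_mul_self e) T.1) (R'.1.map (Fin.succAboveEmb j0))
      rwa [Matrix.mul_apply] at this
    rw [← full]
    simp only [wedgeBlock, Matrix.submatrix_apply]
    rw [← Finset.sum_subtype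
      (Finset.univ.filter fun S : Finset (Fin (2 * (p' + 1) + 1)) => S.card = p' + 1)
      (by simp) (fun S => wedgeMatrix e T.1 S * wedgeMatrix e S (R'.1.map (Fin.succAboveEmb j0)))]
    apply Finset.sum_subset (Finset.filter_subset _ _)
    intro S _ hS
    rw [wedgeMatrix_of_not e (T := S), mul_zero]
    rintro ⟨-, hc⟩
    apply hS
    simp only [Finset.mem_filter, Finset.mem_univ, true_and]
    rw [hc, hcardR]
  -- (ii) they are linearly independent
  have hli : LinearIndependent L (fun (R' : PSub (2 * (p' + 1)) p')
      (S : PSub (2 * (p' + 1) + 1) (p' + 1)) =>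
        wedgeMatrix e S.1 (R'.1.map (Fin.succAboveEmb j0))) := by
    rw [Fintype.linearIndependent_iff]
    intro g hg R₀
    have hS₀ : (insert j0 (R₀.1.map (Fin.succAboveEmb j0))).card = p' + 1 := by
      rw [Finset.card_insert_of_notMem (hj0R R₀), hcardR]
    have h := congrFun hg ⟨insert j0 (R₀.1.map (Fin.succAboveEmb j0)), hS₀⟩
    rw [Finset.sum_apply, Pi.zero_apply, Fintype.sum_eq_single R₀] at h
    · simp only [Pi.smul_apply, smul_eq_mul] at h
      rw [wedgeMatrix_insert e (hj0R R₀)] at h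
      rcases mul_eq_zero.1 h with h | h
      · exact h
      · exfalso
        rcases mul_eq_zero.1 h with h | h
        · have hs := koszulSign_mul_self (R₀.1.map (Fin.succAboveEmb j0)) j0
          apply_fun (fun z : ℤ => (z : L)) at hs
          push_cast at hs
          rw [h, zero_mul] at hs
          exact zero_ne_one hs
        · exact hj0 h
    · intro R hR
      simp only [Pi.smul_apply, smul_eq_mul]
      rw [wedgeMatrix_of_not, mul_zero]
      rintro ⟨hsub, -⟩
      apply hR
      have h1 : R.1.map (Fin.succAboveEmb j0) ⊆ R₀.1.map (Fin.succAboveEmb j0) := by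
        intro x hx
        rcases Finset.mem_insert.1 (hsub hx) with rfl | h
        · exact absurd hx (hj0R R)
        · exact h
      have h2 : R.1.map (Fin.succAboveEmb j0) = R₀.1.map (Fin.succAboveEmb j0) :=
        Finset.eq_of_subset_of_card_le h1 (by rw [hcardR, hcardR])
      exact Subtype.ext (Finset.map_injective (Fin.succAboveEmb j0) h2)
  -- (iii) so the kernel has dimension ≥ binom(2p, p')
  have hker_dim : Fintype.card (PSub (2 * (p' + 1)) p') ≤
      Module.finrank L (LinearMap.ker (wedgeBlock (p' + 1) e).mulVecLin) := by
    have hmem : ∀ R' : PSub (2 * (p' + 1)) p',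
        (fun S : PSub (2 * (p' + 1) + 1) (p' + 1) =>
          wedgeMatrix e S.1 (R'.1.map (Fin.succAboveEmb j0))) ∈
          LinearMap.ker (wedgeBlock (p' + 1) e).mulVecLin := fun R' => by
      rw [LinearMap.mem_ker, Matrix.mulVecLin_apply, hker]
    have hli' := LinearIndependent.of_comp (LinearMap.ker (wedgeBlock (p' + 1) e).mulVecLin).subtype
      (by exact hli : LinearIndependent L
        ((LinearMap.ker (wedgeBlock (p' + 1) e).mulVecLin).subtype ∘ fun R' => ⟨_, hmem R'⟩))
    exact hli'.fintype_card_le_finrank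
  -- (iv) rank-nullity
  have hrn := LinearMap.finrank_range_add_finrank_ker (wedgeBlock (p' + 1) e).mulVecLin
  rw [Module.finrank_fintype_fun_eq_card, card_PSub] at hrn
  rw [card_PSub] at hker_dim
  have hrank : (wedgeBlock (p' + 1) e).rank =
      Module.finrank L (LinearMap.range (wedgeBlock (p' + 1) e).mulVecLin) := rfl
  have hpascal : (2 * (p' + 1) + 1).choose (p' + 1) =
      (2 * (p' + 1)).choose p' + (2 * (p' + 1)).choose (p' + 1) := by
    rw [Nat.choose_succ_succ]
  omega

end WedgeRank

section KoszulRank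

variable {L : Type*} [Field L]

/-- The Koszul flattening of a triad factors through the graded piece of `Φ(w) ∧ ·`:
`K_Φ(w ⊗ u ⊗ v) = D_v · (Φw ∧ ·) · D_u`. [cite: LandsbergGCT2017, §2.4.2 (rank of T_A^{∧p} for T = a⊗b⊗c)] -/
theorem koszulFlattening_triad (p : ℕ) {ι κ μ : Type*}
    (Φ : (ι → L) →ₗ[L] (Fin (2 * p + 1) → L)) (w : ι → L) (u : κ → L) (v : μ → L) :
    koszulFlattening p Φ (triad w u v) =
      (Matrix.of fun (r : PSub (2 * p + 1) (p + 1) × μ) (T' : PSub (2 * p + 1) (p + 1)) =>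
          if r.1 = T' then v r.2 else 0) *
        wedgeBlock p (Φ w) *
        (Matrix.of fun (S' : PSub (2 * p + 1) p) (c : PSub (2 * p + 1) p × κ) =>
          if S' = c.1 then u c.2 else 0) := by
  ext r c
  rw [Matrix.mul_apply]
  simp only [Matrix.mul_apply, Matrix.of_apply, ite_mul, zero_mul, Finset.sum_ite_eq,
    Finset.mem_univ, if_true, mul_ite, mul_zero]
  rw [Finset.sum_ite_eq' Finset.univ c.1, if_pos (Finset.mem_univ _)]
  rw [koszulFlattening_apply]
  have : (fun a => triad w u v a c.2 r.2) = (u c.2 * v r.2) • w := by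
    funext a; simp [triad, mul_comm, mul_left_comm]
  rw [this, map_smul, wedgeMatrix_smul]
  simp only [wedgeBlock, Matrix.submatrix_apply, Matrix.smul_apply, smul_eq_mul]
  ring

/-- `rank K_Φ(w ⊗ u ⊗ v) ≤ binom(2p, p)`. [cite: LandsbergOttaviani2015, §2 ("rank((a⊗b⊗c)_A^{∧p}) = binom(a−1,p)")]
[cite: LandsbergGCT2017, §2.4.2] -/
theorem rank_koszulFlattening_triad_le (p : ℕ) {ι κ μ : Type*} [Fintype κ]
    (Φ : (ι → L) →ₗ[L] (Fin (2 * p + 1) → L)) (w : ι → L) (u : κ → L) (v : μ → L) :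
    (koszulFlattening p Φ (triad w u v)).rank ≤ (2 * p).choose p := by
  rw [koszulFlattening_triad]
  exact ((Matrix.rank_mul_le_left _ _).trans (Matrix.rank_mul_le_right _ _)).trans
    (rank_wedgeBlock_le p (Φ w))

/-- `rank K_Φ(∑_{i<r} w_i ⊗ u_i ⊗ v_i) ≤ binom(2p, p) · r`. [cite: LandsbergOttaviani2015, Thm 2.1 (proof)] -/
theorem rank_koszulFlattening_sum_triad_le (p : ℕ) {ι κ μ : Type*} [Fintype κ]
    (Φ : (ι → L) →ₗ[L] (Fin (2 * p + 1) → L)) {r : ℕ} (w : Fin r → ι → L)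
    (u : Fin r → κ → L) (v : Fin r → μ → L) :
    (koszulFlattening p Φ (∑ i, triad (w i) (u i) (v i))).rank ≤ (2 * p).choose p * r := by
  rw [koszulFlattening_sum]
  refine (matrix_rank_sum_le _ _).trans ?_
  calc ∑ i : Fin r, (koszulFlattening p Φ (triad (w i) (u i) (v i))).rank
      ≤ ∑ _i : Fin r, (2 * p).choose p :=
        Finset.sum_le_sum fun i _ => rank_koszulFlattening_triad_le p Φ (w i) (u i) (v i)
    _ = (2 * p).choose p * r := by simp [mul_comm]

/-- **Landsberg–Ottaviani 2015, Theorem 2.1 (rank form, `dim A' = 2p+1`; GCT Prop 2.4.2.1)**: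
for every tensor `t ∈ L^ι ⊗ L^κ ⊗ L^μ` and every linear map `Φ : L^ι → L^{2p+1}`,
`rank K_Φ(t) ≤ binom(2p, p) · R(t)` — linearity in `t`, subadditivity of rank, and the triad
computation "the image is `a ∧ Λ^p A ⊗ c`". LO2015 state it for border rank
(`R̲(T) ≥ rank T_A^{∧p} / binom(a−1, p)`); the displayed proof is this rank inequality followed by
semicontinuity. [cite: LandsbergOttaviani2015, Thm 2.1 (proof)] [cite: LandsbergGCT2017, Prop 2.4.2.1] -/
theorem LandsbergOttaviani2015_rank_koszulFlattening_le (p : ℕ) {ι κ μ : Type*} [Fintype ι]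
    [Fintype κ] [Fintype μ] (Φ : (ι → L) →ₗ[L] (Fin (2 * p + 1) → L)) (t : ι → κ → μ → L) :
    (koszulFlattening p Φ t).rank ≤ (2 * p).choose p * tensorRank t := by
  obtain ⟨w, u, v, ht⟩ := exists_triad_decomposition_tensorRank t
  have h := rank_koszulFlattening_sum_triad_le p Φ w u v
  rwa [← ht] at h

end KoszulRank

/-! ## Non-degeneracy of `M̃` for `⟨p+1, ·, p+1⟩`: the Vandermonde form of the LO2015 projection -/

section VandermondeSolve

variable {L : Type*} [Field L]

/-- `(ε(S,j) : L) ≠ 0`. [folklore] -/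
theorem cast_koszulSign_ne_zero {K : Type*} [CommRing K] [Nontrivial K] {q : ℕ}
    (S : Finset (Fin q)) (j : Fin q) : (koszulSign S j : K) ≠ 0 := by
  intro h
  have hs := koszulSign_mul_self S j
  apply_fun (fun z : ℤ => (z : K)) at hs
  push_cast at hs
  rw [h, zero_mul] at hs
  exact zero_ne_one hs

/-- Transposed Vandermonde system: if `∑_i c_i^ν x_i = 0` for `ν < |I|` and the `c_i` are distinct,
then `x = 0`. [folklore] -/
theorem eq_zero_of_sum_pow_mul_eq_zero {I : Type*} [Fintype I] {d : ℕ}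
    (hI : Fintype.card I = d) (c : I → L) (hc : Function.Injective c) (x : I → L)
    (h : ∀ ν : Fin d, ∑ i, c i ^ (ν : ℕ) * x i = 0) : x = 0 := by
  classical
  obtain ⟨e⟩ : Nonempty (Fin d ≃ I) := by
    rw [← hI]; exact ⟨(Fintype.equivFin I).symm⟩
  have hdet : (Matrix.vandermonde (c ∘ e)).transpose.det ≠ 0 := by
    rw [Matrix.det_transpose]
    exact Matrix.det_vandermonde_ne_zero_iff.2 (hc.comp e.injective)
  have hx : (Matrix.vandermonde (c ∘ e)).transpose *ᵥ (x ∘ e) = 0 := by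
    funext ν
    rw [Matrix.mulVec, dotProduct, Pi.zero_apply]
    simp only [Matrix.transpose_apply, Matrix.vandermonde_apply, Function.comp_apply]
    rw [← h ν]
    exact Fintype.sum_equiv e _ _ (fun k => rfl)
  have hxe := Matrix.eq_zero_of_mulVec_eq_zero hdet hx
  funext i
  simpa using congrFun hxe (e.symm i)

/-- Vandermonde system: if `∑_κ c_i^κ x_κ = 0` for all `i ∈ I`, `|I| = d`, `deg < d`, and the `c_i` are
distinct, then `x = 0` (a polynomial of degree `< d` with `d` roots vanishes). [folklore] -/
theorem eq_zero_of_sum_pow_mul_eq_zero' {I : Type*} [Fintype I] {d : ℕ}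
    (hI : Fintype.card I = d) (c : I → L) (hc : Function.Injective c) (x : Fin d → L)
    (h : ∀ i : I, ∑ κ : Fin d, c i ^ (κ : ℕ) * x κ = 0) : x = 0 := by
  classical
  obtain ⟨e⟩ : Nonempty (Fin d ≃ I) := by
    rw [← hI]; exact ⟨(Fintype.equivFin I).symm⟩
  have hdet : (Matrix.vandermonde (c ∘ e)).det ≠ 0 :=
    Matrix.det_vandermonde_ne_zero_iff.2 (hc.comp e.injective)
  have hx : Matrix.vandermonde (c ∘ e) *ᵥ x = 0 := by
    funext k
    rw [Matrix.mulVec, dotProduct, Pi.zero_apply]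
    simp only [Matrix.vandermonde_apply, Function.comp_apply]
    exact h (e k)
  exact Matrix.eq_zero_of_mulVec_eq_zero hdet hx

end VandermondeSolve

section VandermondeProj

variable (K : Type*) [CommRing K]

/-- The matrix of the **Vandermonde form of the LO2015 projection**: row `i ∈ {0,…,2p}`, column
`(κ, ν)`, entry `i^{κ+ν}`. This is the multiplication map `S^pW^* ⊗ S^pW^* → S^{2p}W^*`,
`t^κ ⊗ t^ν ↦ t^{κ+ν}` (LO2015 §3; GCT (2.5.2): `u^i ⊗ v_j ↦ e_{i+j−1}`), written in the basis of
`S^{2p}W^* ≅ K^{2p+1}` dual to evaluation at the `2p+1` points `0, 1, …, 2p` (Lagrange basis) instead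
of the monomial basis: `t^{κ+ν} = ∑_i i^{κ+ν} L_i`. [cite: LandsbergOttaviani2015, §3]
[cite: LandsbergGCT2017, (2.5.2)] -/
def vandermondeProjMatrix (p : ℕ) : Matrix (Fin (2 * p + 1)) (Fin (p + 1) × Fin (p + 1)) K :=
  Matrix.of fun i a => ((i : ℕ) : K) ^ ((a.1 : ℕ) + a.2)

/-- The Vandermonde form of the LO2015 projection `K^{(p+1)×(p+1)} → K^{2p+1}`,
`e_{κν} ↦ (i^{κ+ν})_{i=0}^{2p}`, as a linear map. [cite: LandsbergOttaviani2015, §3] -/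
def vandermondeProj (p : ℕ) : (Fin (p + 1) × Fin (p + 1) → K) →ₗ[K] (Fin (2 * p + 1) → K) :=
  (vandermondeProjMatrix K p).mulVecLin

/-- Coordinates of `vandermondeProj p (e_{κν})`. [cite: LandsbergOttaviani2015, §3] -/
theorem vandermondeProj_single (p : ℕ) (κ ν : Fin (p + 1)) (j : Fin (2 * p + 1)) :
    vandermondeProj K p (Pi.single (κ, ν) 1) j = ((j : ℕ) : K) ^ ((κ : ℕ) + ν) := by
  simp [vandermondeProj, vandermondeProjMatrix]

end VandermondeProj

section VandermondeInjective

variable (K : Type*) [Field K] [CharZero K]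

/-- **Non-degeneracy of the reduced Koszul flattening of `⟨p+1, ·, p+1⟩`** (the content of LO2015 §3,
"We claim (r4) is injective", = GCT Thm 2.5.2.6, for the projection in its Vandermonde form): the
square matrix `M̃(vandermondeProj p)` of size `(p+1) binom(2p+1, p)` is injective.
Proof (a Vandermonde argument, in place of the orderings of GCT pp. 47–48): if `z = (z_κ)_κ`,
`z_κ ∈ Λ^p K^{2p+1}`, is in the kernel then `∑_i i^ν e_i ∧ y_i = 0` for `ν ≤ p`, where
`y_i = ∑_κ i^κ z_κ`; coefficientwise this is a Vandermonde system on the `p+1` indices of each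
`(p+1)`-set, so `e_i ∧ y_i = 0` for all `i`, i.e. `(y_i)_S = 0` for `i ∉ S`; for fixed `S` these are
`p + 1` values of the degree-`≤ p` polynomial `∑_κ s^κ (z_κ)_S`, which therefore vanishes.
[cite: LandsbergOttaviani2015, §3 (injectivity of ψ'_p)] [cite: LandsbergGCT2017, Thm 2.5.2.6 (proof)] -/
theorem matMulKoszulMatrix_vandermondeProj_injective (p : ℕ) :
    Function.Injective (matMulKoszulMatrix (p + 1) p (vandermondeProj K p)).mulVec := by
  classical
  set M := matMulKoszulMatrix (p + 1) p (vandermondeProj K p)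
  suffices key : ∀ w, M *ᵥ w = 0 → w = 0 by
    intro z z' h
    exact sub_eq_zero.1 (key (z - z') (by rw [Matrix.mulVec_sub, h, sub_self]))
  intro w hw
  have hc : Function.Injective (fun j : Fin (2 * p + 1) => ((j : ℕ) : K)) :=
    fun i j h => Fin.ext (Nat.cast_injective h)
  have row : ∀ (T : PSub (2 * p + 1) (p + 1)) (ν : Fin (p + 1)),
      ∑ j ∈ T.1, (koszulSign (T.1.erase j) j : K) *
        ∑ κ : Fin (p + 1), ((j : ℕ) : K) ^ ((κ : ℕ) + ν) * extendPSub w (T.1.erase j) κ = 0 := by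
    intro T ν
    have := congrFun hw (T, ν)
    rw [matMulKoszulMatrix_mulVec] at this
    simpa only [vandermondeProj_single, Pi.zero_apply] using this
  -- Step 1: `e_j ∧ y_j = 0`
  have step1 : ∀ (T : PSub (2 * p + 1) (p + 1)) (j : Fin (2 * p + 1)), j ∈ T.1 →
      ∑ κ : Fin (p + 1), ((j : ℕ) : K) ^ (κ : ℕ) * extendPSub w (T.1.erase j) κ = 0 := by
    intro T
    let x : T.1 → K := fun j => (koszulSign (T.1.erase j) j : K) *
      ∑ κ : Fin (p + 1), ((j.1 : ℕ) : K) ^ (κ : ℕ) * extendPSub w (T.1.erase j) κ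
    have hx : x = 0 := by
      refine eq_zero_of_sum_pow_mul_eq_zero (I := T.1) (d := p + 1) (by simp [T.2])
        (fun j => ((j.1 : ℕ) : K)) (fun i j h => Subtype.ext (hc h)) x fun ν => ?_
      have hrow := row T ν
      rw [← Finset.sum_coe_sort] at hrow
      rw [← hrow]
      refine Finset.sum_congr rfl fun j _ => ?_
      simp only [x, Finset.mul_sum]
      refine Finset.sum_congr rfl fun κ _ => ?_
      ring
    intro j hj
    have := congrFun hx ⟨j, hj⟩
    simp only [x, Pi.zero_apply] at this
    rcases mul_eq_zero.1 this with h | h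
    · exact absurd h (cast_koszulSign_ne_zero _ _)
    · exact h
  -- Step 2: for each `S`, the polynomial `∑_κ s^κ (z_κ)_S` has the `p+1` roots `j ∉ S`
  funext ⟨R, κ⟩
  have hI : Fintype.card {j : Fin (2 * p + 1) // j ∉ R.1} = p + 1 := by
    rw [Fintype.card_subtype_compl, Fintype.card_fin, Fintype.card_coe, R.2]
    omega
  have hz := eq_zero_of_sum_pow_mul_eq_zero' (I := {j : Fin (2 * p + 1) // j ∉ R.1}) hI
    (fun j => ((j.1 : ℕ) : K)) (fun i j h => Subtype.ext (hc h)) (fun κ => w (R, κ)) fun j => by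
      have hT : (insert j.1 R.1).card = p + 1 := by
        rw [Finset.card_insert_of_notMem j.2, R.2]
      have := step1 ⟨insert j.1 R.1, hT⟩ j.1 (Finset.mem_insert_self _ _)
      simp only at this
      rw [Finset.erase_insert j.2] at this
      simpa only [extendPSub_val] using this
  exact congrFun hz κ

end VandermondeInjective
/-! ## The case `p = 1`: the commutator projection (Landsberg 2014, §4) -/

section Projections

variable (K : Type*) [CommRing K]

/-- Landsberg 2014, §4, case `p = 1` (`A' = K³`, `T = a₀ ⊗ X₀ + a₁ ⊗ X₁ + a₂ ⊗ X₂` with `X₀ = Id`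
and the relevant determinant `= det [X₁, X₂]`): the `3 × n²` matrix of a projection
`K^{n×n} → K³` whose three coordinate matrices are `X₀ = Id`, `X₁ =` the cyclic shift and
`X₂ = diag(0, 1, …, n−1)`, chosen so that `[X₁, X₂]` is invertible for `n ≥ 2`.
[cite: Landsberg2014, §4 (case p = 1)] -/
def commutatorMatrix (n : ℕ) : Matrix (Fin (2 * 1 + 1)) (Fin n × Fin n) K :=
  Matrix.of fun j a =>
    if j = 0 then (if a.1 = a.2 then 1 else 0)
    else if j = 1 then (if finRotate n a.1 = a.2 then 1 else 0)
    else (if a.1 = a.2 then ((a.1 : ℕ) : K) else 0)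

/-- The projection `K^{n×n} → K³` with coordinate matrices `Id`, cyclic shift, `diag(0,…,n−1)`
(Landsberg 2014, §4, case `p = 1`). [cite: Landsberg2014, §4 (case p = 1)] -/
def commutatorProj (n : ℕ) : (Fin n × Fin n → K) →ₗ[K] (Fin (2 * 1 + 1) → K) :=
  (commutatorMatrix K n).mulVecLin

/-- Coordinates of `commutatorProj n (e_{κν})`. [cite: Landsberg2014, §4 (case p = 1)] -/
theorem commutatorProj_single (n : ℕ) (κ ν : Fin n) (j : Fin (2 * 1 + 1)) :
    commutatorProj K n (Pi.single (κ, ν) 1) j = commutatorMatrix K n j (κ, ν) := by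
  simp [commutatorProj]

/-- `X₀ = Id`: `∑_κ (X₀)_{κν} f_κ = f_ν`. [cite: Landsberg2014, §4 (case p = 1)] -/
theorem sum_commutatorMatrix_zero (n : ℕ) (ν : Fin n) (f : Fin n → K) :
    ∑ κ, commutatorMatrix K n 0 (κ, ν) * f κ = f ν := by
  simp [commutatorMatrix, ite_mul]

/-- `X₁ =` cyclic shift: `∑_κ (X₁)_{κν} f_κ = f_{σ⁻¹ν}`. [cite: Landsberg2014, §4 (case p = 1)] -/
theorem sum_commutatorMatrix_one (n : ℕ) (ν : Fin n) (f : Fin n → K) :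
    ∑ κ, commutatorMatrix K n 1 (κ, ν) * f κ = f ((finRotate n).symm ν) := by
  have h : (1 : Fin (2 * 1 + 1)) ≠ 0 := by decide
  simp only [commutatorMatrix, Matrix.of_apply, if_neg h, if_true, ite_mul, one_mul, zero_mul]
  simp_rw [Equiv.apply_eq_iff_eq_symm_apply (finRotate n)]
  simp

/-- `X₂ = diag(0,…,n−1)`: `∑_κ (X₂)_{κν} f_κ = ν f_ν`. [cite: Landsberg2014, §4 (case p = 1)] -/
theorem sum_commutatorMatrix_two (n : ℕ) (ν : Fin n) (f : Fin n → K) :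
    ∑ κ, commutatorMatrix K n 2 (κ, ν) * f κ = ((ν : ℕ) : K) * f ν := by
  have h : (2 : Fin (2 * 1 + 1)) ≠ 0 := by decide
  have h' : (2 : Fin (2 * 1 + 1)) ≠ 1 := by decide
  simp [commutatorMatrix, h, h', ite_mul]

/-- `finRotate n` has no fixed point for `n ≥ 2`. [folklore] -/
theorem finRotate_apply_ne {n : ℕ} (hn : 2 ≤ n) (k : Fin n) : finRotate n k ≠ k := by
  have : k ∈ (finRotate n).support := by
    rw [support_finRotate_of_le hn]; exact Finset.mem_univ _
  exact Equiv.Perm.mem_support.1 this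

end Projections

/-! ## The case `p = 1`: `M̃(Φ)` is injective for the commutator projection -/

section POne

variable (K : Type*) [Field K] [CharZero K]

/-- **Landsberg 2014, §4, case `p = 1`.** For `n ≥ 2` and the projection `Φ : K^{n×n} → K³` with
coordinate matrices `X₀ = Id`, `X₁ =` cyclic shift, `X₂ = diag(0, …, n−1)`, the reduced Koszul
flattening `M̃(Φ) : K³ ⊗ K^n → Λ²K³ ⊗ K^n` (a `3n × 3n` matrix) is injective. Landsberg computes
its determinant as `det [X₁, X₂]` when `X₀ = Id`; here we check injectivity directly: the three
block rows give `z₁ = X₁ᵀz₀`, `z₂ = X₂ᵀz₀`, `X₂ᵀz₁ = X₁ᵀz₂`, whence `[X₁, X₂]ᵀ z₀ = 0` and `z = 0`.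
[cite: Landsberg2014, §4 (case p = 1: "the determinant … is the same as the determinant of a matrix
of commutators")] -/
theorem matMulKoszulMatrix_commutatorProj_injective (n : ℕ) (hn : 2 ≤ n) :
    Function.Injective (matMulKoszulMatrix n 1 (commutatorProj K n)).mulVec := by
  set M := matMulKoszulMatrix n 1 (commutatorProj K n)
  suffices key : ∀ w, M *ᵥ w = 0 → w = 0 by
    intro z z' h
    exact sub_eq_zero.1 (key (z - z') (by rw [Matrix.mulVec_sub, h, sub_self]))
  intro w hw
  set σ := finRotate n
  have row : ∀ (T : PSub (2 * 1 + 1) (1 + 1)) (ν : Fin n),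
      ∑ j ∈ T.1, (koszulSign (T.1.erase j) j : K) *
        ∑ κ, commutatorMatrix K n j (κ, ν) * extendPSub w (T.1.erase j) κ = 0 := by
    intro T ν
    have := congrFun hw (T, ν)
    rw [matMulKoszulMatrix_mulVec] at this
    simpa only [commutatorProj_single, Pi.zero_apply] using this
  have h01 : ∀ ν, extendPSub w {1} ν = extendPSub w {0} (σ.symm ν) := by
    intro ν
    have := row ⟨{0, 1}, by decide⟩ ν
    dsimp only at this
    have e0 : (({0, 1} : Finset (Fin (2 * 1 + 1))).erase 0) = {1} := by decide
    have e1 : (({0, 1} : Finset (Fin (2 * 1 + 1))).erase 1) = {0} := by decide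
    have s0 : koszulSign ({1} : Finset (Fin (2 * 1 + 1))) 0 = 1 := by decide
    have s1 : koszulSign ({0} : Finset (Fin (2 * 1 + 1))) 1 = -1 := by decide
    rw [Finset.sum_pair (by decide), e0, e1, s0, s1, sum_commutatorMatrix_zero,
      sum_commutatorMatrix_one] at this
    push_cast at this
    linear_combination this
  have h02 : ∀ ν, extendPSub w {2} ν = ((ν : ℕ) : K) * extendPSub w {0} ν := by
    intro ν
    have := row ⟨{0, 2}, by decide⟩ ν
    dsimp only at this
    have e0 : (({0, 2} : Finset (Fin (2 * 1 + 1))).erase 0) = {2} := by decide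
    have e1 : (({0, 2} : Finset (Fin (2 * 1 + 1))).erase 2) = {0} := by decide
    have s0 : koszulSign ({2} : Finset (Fin (2 * 1 + 1))) 0 = 1 := by decide
    have s1 : koszulSign ({0} : Finset (Fin (2 * 1 + 1))) 2 = -1 := by decide
    rw [Finset.sum_pair (by decide), e0, e1, s0, s1, sum_commutatorMatrix_zero,
      sum_commutatorMatrix_two] at this
    push_cast at this
    linear_combination this
  have h12 : ∀ ν, extendPSub w {2} (σ.symm ν) = ((ν : ℕ) : K) * extendPSub w {1} ν := by
    intro ν
    have := row ⟨{1, 2}, by decide⟩ ν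
    dsimp only at this
    have e0 : (({1, 2} : Finset (Fin (2 * 1 + 1))).erase 1) = {2} := by decide
    have e1 : (({1, 2} : Finset (Fin (2 * 1 + 1))).erase 2) = {1} := by decide
    have s0 : koszulSign ({2} : Finset (Fin (2 * 1 + 1))) 1 = 1 := by decide
    have s1 : koszulSign ({1} : Finset (Fin (2 * 1 + 1))) 2 = -1 := by decide
    rw [Finset.sum_pair (by decide), e0, e1, s0, s1, sum_commutatorMatrix_one,
      sum_commutatorMatrix_two] at this
    push_cast at this
    linear_combination this
  have hw0 : ∀ κ, extendPSub w {0} κ = 0 := by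
    intro κ
    have hne : σ κ ≠ κ := finRotate_apply_ne hn κ
    have e1 := h01 (σ κ)
    have e2 := h02 κ
    have e3 := h12 (σ κ)
    rw [Equiv.symm_apply_apply] at e1 e3
    have h : ((((σ κ : Fin n) : ℕ) : K) - ((κ : ℕ) : K)) * extendPSub w {0} κ = 0 := by
      linear_combination e2 - e3 - (((σ κ : Fin n) : ℕ) : K) * e1
    rcases mul_eq_zero.1 h with h | h
    · exact absurd (Fin.ext (Nat.cast_injective (R := K) (sub_eq_zero.1 h))) hne
    · exact h
  have hw1 : ∀ ν, extendPSub w {1} ν = 0 := fun ν => by rw [h01, hw0]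
  have hw2 : ∀ ν, extendPSub w {2} ν = 0 := fun ν => by rw [h02, hw0, mul_zero]
  funext ⟨S, κ⟩
  obtain ⟨j, hj⟩ := Finset.card_eq_one.1 S.2
  have hS : w (S, κ) = extendPSub w {j} κ := by rw [← extendPSub_val w S κ, hj]
  rw [Pi.zero_apply, hS]
  fin_cases j
  · simpa using hw0 κ
  · simpa using hw1 κ
  · simpa using hw2 κ

end POne

/-! ## From injectivity to non-vanishing minors; block-diagonal projections -/

section Blocks

/-- A matrix with injective `mulVec` between index types of the same size has a non-zero
maximal minor (after identifying columns with rows). [folklore] -/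
theorem exists_det_submatrix_ne_zero_of_injective {L : Type*} [Field L] {R C : Type*}
    [Fintype R] [Fintype C] [DecidableEq R] (M : Matrix R C L)
    (hcard : Fintype.card R = Fintype.card C) (h : Function.Injective M.mulVec) :
    ∃ ε : R ≃ C, (M.submatrix id ε).det ≠ 0 := by
  refine ⟨Fintype.equivOfCardEq hcard, ?_⟩
  set ε := Fintype.equivOfCardEq hcard
  have hinj : Function.Injective (M.submatrix id ε).mulVec := by
    intro v v' hv
    rw [Matrix.submatrix_mulVec_equiv, Matrix.submatrix_mulVec_equiv, Function.comp_id,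
      Function.comp_id] at hv
    have hv' := h hv
    funext i
    simpa using congrFun hv' (ε i)
  have hU : IsUnit (M.submatrix id ε) := Matrix.mulVec_injective_iff_isUnit.1 hinj
  exact ((Matrix.isUnit_iff_isUnit_det _).1 hU).ne_zero

variable {K : Type*} [CommRing K]

/-- The global index in `Fin n` of the local index `i` of the `b`-th consecutive block of size
`p + 1` (`b < n / (p+1)`). [folklore] -/
def blk (n p : ℕ) (b : Fin (n / (p + 1))) (i : Fin (p + 1)) : Fin n :=
  ⟨(p + 1) * b + i, by
    have hb := b.2
    have hi := i.2
    calc (p + 1) * b + i < (p + 1) * b + (p + 1) := by omega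
      _ = (p + 1) * (b + 1) := by ring
      _ ≤ (p + 1) * (n / (p + 1)) := Nat.mul_le_mul_left _ hb
      _ ≤ n := Nat.mul_div_le n (p + 1)⟩

/-- `(b, i) ↦ blk n p b i` is injective. [folklore] -/
theorem blk_inj (n p : ℕ) {b b' : Fin (n / (p + 1))} {i i' : Fin (p + 1)}
    (h : blk n p b i = blk n p b' i') : b = b' ∧ i = i' := by
  have hv : (p + 1) * (b : ℕ) + i = (p + 1) * b' + i' := congrArg Fin.val h
  have hi := i.2
  have hi' := i'.2
  have h1 : (b : ℕ) = b' := by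
    have := congrArg (· / (p + 1)) hv
    simpa [Nat.mul_add_div (Nat.succ_pos p), Nat.div_eq_of_lt hi, Nat.div_eq_of_lt hi'] using this
  have h2 : (i : ℕ) = i' := by
    have := congrArg (· % (p + 1)) hv
    simpa [Nat.mul_add_mod, Nat.mod_eq_of_lt hi, Nat.mod_eq_of_lt hi'] using this
  exact ⟨Fin.ext h1, Fin.ext h2⟩

/-- The block-diagonal projection `K^{n×n} → E` built from `Φ₀ : K^{(p+1)×(p+1)} → E`:
`e_{κν} ↦ Φ₀(e_{κ'ν'})` if `κ, ν` lie in the same block of size `p+1` (local indices `κ', ν'`),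
and `↦ 0` otherwise (Landsberg's error-term bookkeeping replaced by consecutive blocks).
[folklore] -/
def blockProj (n p : ℕ) (Φ₀ : (Fin (p + 1) × Fin (p + 1) → K) →ₗ[K] (Fin (2 * p + 1) → K)) :
    (Fin n × Fin n → K) →ₗ[K] (Fin (2 * p + 1) → K) :=
  ∑ b : Fin (n / (p + 1)),
    Φ₀ ∘ₗ LinearMap.funLeft K K
      (fun ij : Fin (p + 1) × Fin (p + 1) => (blk n p b ij.1, blk n p b ij.2))

/-- `blockProj Φ₀ (e_{κν}) = Φ₀(e_{κ'ν'})` when `κ, ν` are in the same block, `0` otherwise.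
[folklore] -/
theorem blockProj_single (n p : ℕ)
    (Φ₀ : (Fin (p + 1) × Fin (p + 1) → K) →ₗ[K] (Fin (2 * p + 1) → K))
    (b b' : Fin (n / (p + 1))) (i i' : Fin (p + 1)) :
    blockProj n p Φ₀ (Pi.single (blk n p b i, blk n p b' i') 1) =
      if b = b' then Φ₀ (Pi.single (i, i') 1) else 0 := by
  simp only [blockProj, LinearMap.coe_sum, Finset.sum_apply, LinearMap.comp_apply]
  have key : ∀ b'' : Fin (n / (p + 1)),
      LinearMap.funLeft K K
        (fun ij : Fin (p + 1) × Fin (p + 1) => (blk n p b'' ij.1, blk n p b'' ij.2))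
        (Pi.single (blk n p b i, blk n p b' i') (1 : K)) =
      if b'' = b ∧ b'' = b' then Pi.single (i, i') 1 else 0 := by
    intro b''
    by_cases hb : b'' = b ∧ b'' = b'
    · obtain ⟨rfl, rfl⟩ := hb
      rw [if_pos ⟨rfl, rfl⟩]
      funext ij
      rw [LinearMap.funLeft_apply]
      by_cases hij : ij = (i, i')
      · subst hij; simp
      · rw [Pi.single_eq_of_ne hij, Pi.single_eq_of_ne]
        intro h
        apply hij
        obtain ⟨h1, h2⟩ := Prod.ext_iff.1 h
        exact Prod.ext (blk_inj n p h1).2 (blk_inj n p h2).2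
    · rw [if_neg hb]
      funext ij
      rw [LinearMap.funLeft_apply, Pi.zero_apply, Pi.single_eq_of_ne]
      intro h
      obtain ⟨h1, h2⟩ := Prod.ext_iff.1 h
      exact hb ⟨(blk_inj n p h1).1, (blk_inj n p h2).1⟩
  simp only [key]
  by_cases hbb : b = b'
  · subst hbb
    rw [if_pos rfl, Fintype.sum_eq_single b]
    · simp
    · intro b'' hb''
      rw [if_neg (fun h => hb'' h.1), map_zero]
  · rw [if_neg hbb]
    refine Finset.sum_eq_zero fun b'' _ => ?_
    rw [if_neg, map_zero]
    rintro ⟨rfl, rfl⟩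
    exact hbb rfl

/-- On the rows/columns of the full blocks, `M̃(blockProj Φ₀)` is block diagonal with blocks
`M̃(Φ₀)`; hence a non-zero maximal minor of `M̃(Φ₀)` gives a non-zero minor of
`M̃(blockProj Φ₀)` of size `n / (p+1)` times as large. [folklore] -/
theorem det_blocks_ne_zero {L : Type*} [Field L] (n p : ℕ)
    (Φ₀ : (Fin (p + 1) × Fin (p + 1) → L) →ₗ[L] (Fin (2 * p + 1) → L))
    (ε : (PSub (2 * p + 1) (p + 1) × Fin (p + 1)) ≃ (PSub (2 * p + 1) p × Fin (p + 1)))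
    (h : ((matMulKoszulMatrix (p + 1) p Φ₀).submatrix id ε).det ≠ 0) :
    ((matMulKoszulMatrix n p (blockProj n p Φ₀)).submatrix
        (fun x : (PSub (2 * p + 1) (p + 1) × Fin (p + 1)) × Fin (n / (p + 1)) =>
          (x.1.1, blk n p x.2 x.1.2))
        (fun x => ((ε x.1).1, blk n p x.2 (ε x.1).2))).det ≠ 0 := by
  have hM : (matMulKoszulMatrix n p (blockProj n p Φ₀)).submatrix
        (fun x : (PSub (2 * p + 1) (p + 1) × Fin (p + 1)) × Fin (n / (p + 1)) =>
          (x.1.1, blk n p x.2 x.1.2))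
        (fun x => ((ε x.1).1, blk n p x.2 (ε x.1).2)) =
      Matrix.blockDiagonal
        (fun _ : Fin (n / (p + 1)) => (matMulKoszulMatrix (p + 1) p Φ₀).submatrix id ε) := by
    ext ⟨x, b⟩ ⟨x', b'⟩
    simp only [Matrix.submatrix_apply, matMulKoszulMatrix_apply, Matrix.blockDiagonal_apply',
      blockProj_single, id]
    by_cases hb : b = b'
    · subst hb
      rw [if_pos rfl, if_pos rfl]
    · rw [if_neg (Ne.symm hb), if_neg hb, wedgeMatrix_zero]
      rfl
  rw [hM, Matrix.det_blockDiagonal, Finset.prod_const, Finset.card_univ, Fintype.card_fin]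
  exact pow_ne_zero _ h

end Blocks


/-! ## Landsberg 2014, Prop 2.1 + Lemma 2.2 + §3: the mechanism -/

section PropTwoOne

/-- `wedgeMatrix` commutes with ring homomorphisms applied entrywise. [folklore] -/
theorem wedgeMatrix_map {K K' : Type*} [CommRing K] [CommRing K'] {q : ℕ} (f : K →+* K')
    (e : Fin q → K) (T S : Finset (Fin q)) :
    f (wedgeMatrix e T S) = wedgeMatrix (⇑f ∘ e) T S := by
  simp only [wedgeMatrix_apply, map_sum]
  refine Finset.sum_congr rfl fun j _ => ?_
  split_ifs <;> simp

/-- A triad whose first vector is killed by `Φ` has zero Koszul flattening.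
[cite: Landsberg2014, proof of Prop 2.1] -/
theorem koszulFlattening_triad_of_map_eq_zero {K : Type*} [CommRing K] (p : ℕ) {ι κ μ : Type*}
    (Φ : (ι → K) →ₗ[K] (Fin (2 * p + 1) → K)) (w : ι → K) (u : κ → K) (v : μ → K)
    (h : Φ w = 0) : koszulFlattening p Φ (triad w u v) = 0 := by
  ext r c
  rw [koszulFlattening_apply]
  have : (fun a => triad w u v a c.2 r.2) = (u c.2 * v r.2) • w := by
    funext a; simp [triad, mul_comm, mul_left_comm]
  rw [this, map_smul, h, smul_zero, wedgeMatrix_zero]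
  rfl

/-- The slices of `⟨n, m, n⟩` in the first factor: `⟨n,m,n⟩(·, (κ,μ'), (μ,ν)) = [μ' = μ] e_{κν}`.
[cite: Blaser2013, §5 (the tensor ⟨k,m,n⟩)] -/
theorem matMulTensor_slice (K : Type*) [CommSemiring K] (n m : ℕ) (κ ν : Fin n) (μ' μ : Fin m) :
    (fun a : Fin n × Fin n => matMulTensor K n m n a (κ, μ') (μ, ν)) =
      if μ' = μ then Pi.single (κ, ν) 1 else 0 := by
  funext a
  by_cases h : μ' = μ
  · subst h
    by_cases ha : a = (κ, ν)
    · subst ha; simp [matMulTensor]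
    · rw [if_pos rfl, Pi.single_eq_of_ne ha]
      simp only [matMulTensor, true_and]
      rw [if_neg]
      intro h'
      exact ha (Prod.ext h'.1 h'.2)
  · simp [matMulTensor, h]

/-- **`K_Φ(⟨n,m,n⟩) = M̃(Φ) ⊗ Id_m`** on the relevant rows and columns: the submatrix of the Koszul
flattening of `⟨n, m, n⟩` on rows `((T_i, (μ, ν_i)))_{(i, μ)}` and columns `((S_i, (κ_i, μ)))_{(i,μ)}`
is block diagonal with `m` copies of the corresponding submatrix of `M̃(Φ)` (Landsberg 2014, §3:
"is actually a reduced map … tensored with the identity map"). [cite: Landsberg2014, §3] -/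
theorem koszulFlattening_matMul_submatrix {K : Type*} [CommRing K] (n m p : ℕ)
    (Φ : (Fin n × Fin n → K) →ₗ[K] (Fin (2 * p + 1) → K)) {ι : Type*}
    (er : ι → PSub (2 * p + 1) (p + 1) × Fin n) (ec : ι → PSub (2 * p + 1) p × Fin n) :
    (koszulFlattening p Φ (matMulTensor K n m n)).submatrix
        (fun x : ι × Fin m => ((er x.1).1, (x.2, (er x.1).2)))
        (fun x : ι × Fin m => ((ec x.1).1, ((ec x.1).2, x.2))) =
      Matrix.blockDiagonal fun _ : Fin m => (matMulKoszulMatrix n p Φ).submatrix er ec := by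
  ext ⟨i, μ⟩ ⟨i', μ'⟩
  simp only [Matrix.submatrix_apply, koszulFlattening_apply, Matrix.blockDiagonal_apply',
    matMulKoszulMatrix_apply]
  rw [matMulTensor_slice]
  by_cases h : μ' = μ
  · subst h; simp
  · rw [if_neg h, if_neg (Ne.symm h), map_zero, wedgeMatrix_zero]
    rfl

/-- In an (optimal or not) decomposition `⟨n, m, n⟩ = ∑ w_i ⊗ u_i ⊗ v_i` (`m ≥ 1`) the vectors
`w_i` span the first factor `K^{n×n}` — because the slices of `⟨n,m,n⟩` are linearly independent
("`T : A^* → B ⊗ C` is injective", Landsberg 2014, Prop 2.1). [cite: Landsberg2014, Prop 2.1 (proof)] -/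
theorem span_eq_top_of_matMul_decomposition {K : Type*} [Field K] {n m : ℕ} [NeZero m] {r : ℕ}
    (w : Fin r → (Fin n × Fin n → K)) (u : Fin r → (Fin n × Fin m → K))
    (v : Fin r → (Fin m × Fin n → K))
    (ht : matMulTensor K n m n = ∑ i, triad (w i) (u i) (v i)) :
    Submodule.span K (Set.range w) = ⊤ := by
  by_contra hne
  obtain ⟨f, hf, hle⟩ := Submodule.exists_le_ker_of_lt_top _ (lt_top_iff_ne_top.2 hne)
  have hfw : ∀ i, f (w i) = 0 := fun i =>
    LinearMap.mem_ker.1 (hle (Submodule.subset_span ⟨i, rfl⟩))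
  have hfx : ∀ x : Fin n × Fin n → K, f x = ∑ a, x a * f (Pi.single a 1) := by
    intro x
    conv_lhs => rw [← Finset.univ_sum_single x]
    rw [map_sum]
    refine Finset.sum_congr rfl fun a _ => ?_
    rw [← smul_eq_mul, ← map_smul]
    congr 1
    funext a'
    by_cases h : a' = a
    · subst h; simp
    · simp [Pi.single_eq_of_ne h]
  have hlin := linearIndependent_matMulTensor K n m n
  rw [Fintype.linearIndependent_iff] at hlin
  have hψ : ∀ a, f (Pi.single a 1) = 0 := by
    apply hlin
    funext b c
    rw [Finset.sum_apply, Finset.sum_apply, Pi.zero_apply, Pi.zero_apply]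
    simp only [Pi.smul_apply, smul_eq_mul]
    have hexp : ∀ a, matMulTensor K n m n a b c = ∑ i, w i a * u i b * v i c := by
      intro a; rw [ht]; simp [Finset.sum_apply, triad_apply]
    simp_rw [hexp, Finset.mul_sum]
    rw [Finset.sum_comm]
    refine Finset.sum_eq_zero fun i _ => ?_
    have : ∑ a, f (Pi.single a 1) * (w i a * u i b * v i c) = f (w i) * (u i b * v i c) := by
      rw [hfx (w i), Finset.sum_mul]
      refine Finset.sum_congr rfl fun a _ => ?_
      ring
    rw [this, hfw i, zero_mul]
  refine hf (LinearMap.ext fun x => ?_)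
  rw [hfx x]
  simp [hψ]

/-- The determinant of a matrix of polynomials of degree `≤ 1` has degree at most its size.
[folklore] -/
theorem totalDegree_det_le {R : Type*} [CommRing R] {σ ι : Type*} [Fintype ι] [DecidableEq ι]
    (N : Matrix ι ι (MvPolynomial σ R)) (h : ∀ i j, (N i j).totalDegree ≤ 1) :
    N.det.totalDegree ≤ Fintype.card ι := by
  rw [Matrix.det_apply']
  refine MvPolynomial.totalDegree_finsetSum_le fun τ _ => ?_
  refine (MvPolynomial.totalDegree_mul _ _).trans ?_
  have h1 : (((Equiv.Perm.sign τ : ℤˣ) : ℤ) : MvPolynomial σ R).totalDegree = 0 := by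
    rw [← map_intCast (MvPolynomial.C : R →+* MvPolynomial σ R), MvPolynomial.totalDegree_C]
  rw [h1, zero_add]
  refine (MvPolynomial.totalDegree_finsetProd _ _).trans ?_
  calc ∑ i, (N (τ i) i).totalDegree ≤ ∑ _i : ι, 1 := Finset.sum_le_sum fun i _ => h _ _
    _ = Fintype.card ι := by simp

/-- **Landsberg 2014, Lemma 2.2** ("Given a polynomial `P` of degree `d` on `ℂ^a` [with a basis],
there exists a set of at most `d` basis vectors such that `P` restricted to their span is not
identically zero. The lemma follows by simply choosing a monomial that appears in `P`, as it can
involve at most `d` basis vectors."), for variables indexed by `κ × τ` (the "basis vectors" being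
the first indices), over an infinite integral domain. [cite: Landsberg2014, Lemma 2.2] -/
theorem Landsberg2014_lemma_2_2 {R : Type*} [CommRing R] [IsDomain R] [Infinite R]
    {κ τ : Type*} [DecidableEq κ] (P : MvPolynomial (κ × τ) R) (hP : P ≠ 0) :
    ∃ (S : Finset κ) (y : κ × τ → R), S.card ≤ P.totalDegree ∧ (∀ v, v.1 ∉ S → y v = 0) ∧
      MvPolynomial.eval y P ≠ 0 := by
  classical
  obtain ⟨d, hd⟩ := MvPolynomial.ne_zero_iff.1 hP
  have hd' : d ∈ P.support := MvPolynomial.mem_support_iff.2 hd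
  set S : Finset κ := d.support.image Prod.fst with hS
  set good : ((κ × τ) →₀ ℕ) → Prop := fun d' => ∀ v ∈ d'.support, v.1 ∈ S with hgood
  set P₁ := ∑ d' ∈ P.support.filter good, MvPolynomial.monomial d' (P.coeff d') with hP₁
  set P₂ := ∑ d' ∈ P.support.filter (fun d' => ¬ good d'), MvPolynomial.monomial d' (P.coeff d')
    with hP₂
  have hsplit : P = P₁ + P₂ := by
    conv_lhs => rw [P.as_sum]
    rw [hP₁, hP₂, Finset.sum_filter_add_sum_filter_not]
  have hdgood : good d := fun v hv => Finset.mem_image_of_mem _ hv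
  have hP₁ne : P₁ ≠ 0 := by
    intro h0
    have : P₁.coeff d = P.coeff d := by
      rw [hP₁, MvPolynomial.coeff_sum]
      simp only [MvPolynomial.coeff_monomial]
      rw [Finset.sum_ite_eq' (P.support.filter good) d (fun d' => P.coeff d'),
        if_pos (Finset.mem_filter.2 ⟨hd', hdgood⟩)]
    rw [h0, MvPolynomial.coeff_zero] at this
    exact hd this.symm
  obtain ⟨z, hz⟩ : ∃ z, MvPolynomial.eval z P₁ ≠ 0 := by
    by_contra h
    push Not at h
    exact hP₁ne (MvPolynomial.funext (fun x => by rw [h x, map_zero]))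
  refine ⟨S, fun v => if v.1 ∈ S then z v else 0, ?_, fun v hv => if_neg hv, ?_⟩
  · calc S.card ≤ d.support.card := Finset.card_image_le
      _ = ∑ _v ∈ d.support, 1 := by simp
      _ ≤ ∑ v ∈ d.support, d v := Finset.sum_le_sum fun v hv =>
          Nat.one_le_iff_ne_zero.2 (Finsupp.mem_support_iff.1 hv)
      _ ≤ P.totalDegree := MvPolynomial.le_totalDegree hd'
  · rw [hsplit, map_add]
    have h2 : MvPolynomial.eval (fun v => if v.1 ∈ S then z v else 0) P₂ = 0 := by
      rw [hP₂, map_sum]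
      refine Finset.sum_eq_zero fun d' hd'mem => ?_
      obtain ⟨v, hv, hvS⟩ : ∃ v ∈ d'.support, v.1 ∉ S := by
        have := (Finset.mem_filter.1 hd'mem).2
        simp only [hgood] at this
        push Not at this
        exact this
      rw [MvPolynomial.eval_monomial, Finsupp.prod, Finset.prod_eq_zero hv, mul_zero]
      rw [if_neg hvS, zero_pow (Finsupp.mem_support_iff.1 hv)]
    have h1 : MvPolynomial.eval (fun v => if v.1 ∈ S then z v else 0) P₁ =
        MvPolynomial.eval z P₁ := by
      rw [hP₁, map_sum, map_sum]
      refine Finset.sum_congr rfl fun d' hd'mem => ?_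
      have hg : good d' := (Finset.mem_filter.1 hd'mem).2
      rw [MvPolynomial.eval_monomial, MvPolynomial.eval_monomial, Finsupp.prod, Finsupp.prod]
      congr 1
      refine Finset.prod_congr rfl fun v hv => ?_
      rw [if_pos (hg v hv)]
    rw [h1, h2, add_zero]
    exact hz

/-- **Landsberg 2014, Proposition 2.1 with Lemma 2.2, applied to the reduced Koszul flattening of
`⟨n, m, n⟩` (§3)** — the mechanism of the paper: if for some `Φ : ℂ^{n×n} → ℂ^{2p+1}` the reduced
Koszul matrix `M̃(Φ)` of `⟨n, m, n⟩` (`m ≥ 1`) has a non-zero minor of size `ρ = |ι|`, then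
`m ρ + binom(2p,p) n² ≤ binom(2p,p) (ρ + R(⟨n, m, n⟩))`, i.e. `R(⟨n,m,n⟩) ≥ n² + (m/binom(2p,p) − 1) ρ`.
Proof as in the source: write an optimal decomposition `⟨n,m,n⟩ = ∑_{i<r} a_i ⊗ b_i ⊗ c_i`; the `a_i`
span `A = ℂ^{n×n}` (Prop 2.1: "`T : A^* → B ⊗ C` is injective"); pick a basis `(a_i)_{i ∈ I}` among
them and parametrise `Φ` by `x_i = Φ(a_i)`; the minor is a polynomial of degree `≤ ρ` in the `x_i`,
non-zero, so by Lemma 2.2 it stays non-zero with all but `≤ ρ` of the `x_i` set to `0`; for such `Φ`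
the Koszul flattening of `⟨n,m,n⟩` (`⊇ M̃(Φ)|_minor ⊗ Id_m`, rank `≥ mρ`, §3) equals that of the
`≤ ρ + r − n²` surviving terms, of rank `≤ binom(2p,p)(ρ + r − n²)` by LO2015 Thm 2.1.
[cite: Landsberg2014, Prop 2.1, Lemma 2.2 and §3 (M̃^{∧p}_{A'} "tensored with the identity map")] -/
theorem Landsberg2014_prop_2_1_koszul (n m p : ℕ) (hm : 0 < m)
    (Φ : (Fin n × Fin n → ℂ) →ₗ[ℂ] (Fin (2 * p + 1) → ℂ)) {ι : Type*} [Fintype ι] [DecidableEq ι]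
    (er : ι → PSub (2 * p + 1) (p + 1) × Fin n) (ec : ι → PSub (2 * p + 1) p × Fin n)
    (hdet : ((matMulKoszulMatrix n p Φ).submatrix er ec).det ≠ 0) :
    m * Fintype.card ι + (2 * p).choose p * n ^ 2 ≤
      (2 * p).choose p * (Fintype.card ι + tensorRank (matMulTensor ℂ n m n)) := by
  classical
  haveI : NeZero m := ⟨hm.ne'⟩
  haveI : Infinite ℂ := Infinite.of_injective ((↑) : ℕ → ℂ) Nat.cast_injective
  obtain ⟨w, u, v, ht⟩ := exists_triad_decomposition_tensorRank (matMulTensor ℂ n m n)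
  -- the `w_i` span; extract a basis `b k = w (a k)`
  have hspan : Submodule.span ℂ (Set.range w) = ⊤ :=
    span_eq_top_of_matMul_decomposition w u v ht
  obtain ⟨κ', a, ha, hspan', hli⟩ := exists_linearIndependent' ℂ w
  haveI : Fintype κ' := Fintype.ofInjective a ha
  let b : Module.Basis κ' ℂ (Fin n × Fin n → ℂ) := Module.Basis.mk hli (by rw [hspan', hspan])
  have hb : ∀ k, b k = w (a k) := fun k => Module.Basis.mk_apply hli _ k
  have hcardκ : Fintype.card κ' = n ^ 2 := by
    have := Module.finrank_eq_card_basis b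
    rw [Module.finrank_fintype_fun_eq_card, Fintype.card_prod, Fintype.card_fin] at this
    rw [← this, sq]
  have hn2r : n ^ 2 ≤ tensorRank (matMulTensor ℂ n m n) := by
    rw [← hcardκ, ← Fintype.card_fin (tensorRank (matMulTensor ℂ n m n))]
    exact Fintype.card_le_of_injective a ha
  -- the generic reduced Koszul matrix, entries linear forms in `x_{k j} = Φ(b k)_j`
  let coef : κ' → Fin n → Fin n → ℂ := fun k κ ν => b.repr (Pi.single (κ, ν) 1) k
  let eGen : Fin n → Fin n → Fin (2 * p + 1) → MvPolynomial (κ' × Fin (2 * p + 1)) ℂ :=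
    fun κ ν j => ∑ k, MvPolynomial.C (coef k κ ν) * MvPolynomial.X (k, j)
  let Mgen : Matrix (PSub (2 * p + 1) (p + 1) × Fin n) (PSub (2 * p + 1) p × Fin n)
      (MvPolynomial (κ' × Fin (2 * p + 1)) ℂ) :=
    Matrix.of fun r c => wedgeMatrix (eGen c.2 r.2) r.1.1 c.1.1
  let P : MvPolynomial (κ' × Fin (2 * p + 1)) ℂ := (Mgen.submatrix er ec).det
  let Φy : (κ' × Fin (2 * p + 1) → ℂ) → ((Fin n × Fin n → ℂ) →ₗ[ℂ] (Fin (2 * p + 1) → ℂ)) :=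
    fun y => b.constr ℂ (fun k j => y (k, j))
  have hΦy_single : ∀ y κ ν j, Φy y (Pi.single (κ, ν) 1) j = ∑ k, coef k κ ν * y (k, j) := by
    intro y κ ν j
    simp only [Φy, Module.Basis.constr_apply_fintype, Module.Basis.equivFun_apply,
      Finset.sum_apply, Pi.smul_apply, smul_eq_mul, coef]
  have heval : ∀ y, MvPolynomial.eval y P =
      ((matMulKoszulMatrix n p (Φy y)).submatrix er ec).det := by
    intro y
    simp only [P]
    rw [RingHom.map_det, RingHom.mapMatrix_apply, ← Matrix.submatrix_map]
    congr 1
    ext i i'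
    simp only [Matrix.submatrix_apply, Matrix.map_apply, Mgen, Matrix.of_apply,
      matMulKoszulMatrix_apply]
    rw [wedgeMatrix_map]
    congr 1
    funext j
    simp only [Function.comp_apply, eGen, map_sum, map_mul, MvPolynomial.eval_C,
      MvPolynomial.eval_X]
    rw [hΦy_single]
  -- `P ≠ 0` since `P(Φ) ≠ 0`
  have hP : P ≠ 0 := by
    intro h0
    apply hdet
    have hy0 := heval (fun v => Φ (b v.1) v.2)
    have hΦ : Φy (fun v => Φ (b v.1) v.2) = Φ := b.constr_self ℂ Φ
    rw [hΦ, h0, map_zero] at hy0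
    exact hy0.symm
  -- `deg P ≤ |ι|`
  have hdeg : P.totalDegree ≤ Fintype.card ι := by
    apply totalDegree_det_le
    intro i i'
    simp only [Matrix.submatrix_apply, Mgen, Matrix.of_apply, wedgeMatrix_apply]
    refine MvPolynomial.totalDegree_finsetSum_le fun j _ => ?_
    split_ifs
    · refine (MvPolynomial.totalDegree_mul _ _).trans ?_
      have h1 : ∀ z : ℤ, ((z : MvPolynomial (κ' × Fin (2 * p + 1)) ℂ)).totalDegree = 0 := by
        intro z
        rw [← map_intCast (MvPolynomial.C : ℂ →+* _), MvPolynomial.totalDegree_C]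
      rw [h1, zero_add]
      refine MvPolynomial.totalDegree_finsetSum_le fun k _ => ?_
      refine (MvPolynomial.totalDegree_mul _ _).trans ?_
      rw [MvPolynomial.totalDegree_C, MvPolynomial.totalDegree_X, zero_add]
    · rw [MvPolynomial.totalDegree_zero]
      exact Nat.zero_le _
  -- Lemma 2.2: a point supported on `≤ deg P` first indices
  obtain ⟨Sset, y, hScard, hy0, hyP⟩ := Landsberg2014_lemma_2_2 P hP
  have hSι : Sset.card ≤ Fintype.card ι := hScard.trans hdeg
  have hΦ'zero : ∀ k, k ∉ Sset → Φy y (w (a k)) = 0 := by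
    intro k hk
    rw [← hb k]
    simp only [Φy, Module.Basis.constr_basis]
    funext j
    exact hy0 (k, j) hk
  have hdet' : ((matMulKoszulMatrix n p (Φy y)).submatrix er ec).det ≠ 0 := by
    rw [← heval]; exact hyP
  -- lower bound: `K_{Φ'}(⟨n,m,n⟩) ⊇ M̃(Φ')|_{minor} ⊗ Id_m`, invertible of size `m |ι|`
  have hlow : m * Fintype.card ι ≤ (koszulFlattening p (Φy y) (matMulTensor ℂ n m n)).rank := by
    have hsub := koszulFlattening_matMul_submatrix n m p (Φy y) er ec
    have hunit : IsUnit ((koszulFlattening p (Φy y) (matMulTensor ℂ n m n)).submatrix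
        (fun x : ι × Fin m => ((er x.1).1, (x.2, (er x.1).2)))
        (fun x : ι × Fin m => ((ec x.1).1, ((ec x.1).2, x.2)))) := by
      rw [Matrix.isUnit_iff_isUnit_det, hsub, Matrix.det_blockDiagonal, Finset.prod_const]
      exact IsUnit.pow _ (isUnit_iff_ne_zero.2 hdet')
    calc m * Fintype.card ι = Fintype.card (ι × Fin m) := by simp [mul_comm]
      _ = ((koszulFlattening p (Φy y) (matMulTensor ℂ n m n)).submatrix
        (fun x : ι × Fin m => ((er x.1).1, (x.2, (er x.1).2)))
        (fun x : ι × Fin m => ((ec x.1).1, ((ec x.1).2, x.2)))).rank :=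
          (Matrix.rank_of_isUnit _ hunit).symm
      _ ≤ _ := Matrix.rank_submatrix_le _ _ _
  -- upper bound: only the terms `l ∉ a(κ' ∖ Sset)` survive
  let Lset : Finset (Fin (tensorRank (matMulTensor ℂ n m n))) :=
    Finset.univ.filter fun l => ∀ k, a k = l → k ∈ Sset
  have hK : koszulFlattening p (Φy y) (matMulTensor ℂ n m n) =
      koszulFlattening p (Φy y) (∑ l ∈ Lset, triad (w l) (u l) (v l)) := by
    have ht' : matMulTensor ℂ n m n = (∑ l ∈ Lset, triad (w l) (u l) (v l)) +
        ∑ l ∈ Finset.univ.filter (fun l => ¬ ∀ k, a k = l → k ∈ Sset),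
          triad (w l) (u l) (v l) := by
      rw [Finset.sum_filter_add_sum_filter_not]; exact ht
    have hzero : ∑ l ∈ Finset.univ.filter (fun l => ¬ ∀ k, a k = l → k ∈ Sset),
        koszulFlattening p (Φy y) (triad (w l) (u l) (v l)) = 0 := by
      refine Finset.sum_eq_zero fun l hl => ?_
      obtain ⟨k, hk, hkS⟩ : ∃ k, a k = l ∧ k ∉ Sset := by
        have := (Finset.mem_filter.1 hl).2
        push Not at this
        exact this
      apply koszulFlattening_triad_of_map_eq_zero
      rw [← hk]
      exact hΦ'zero k hkS
    rw [congrArg (koszulFlattening p (Φy y)) ht', koszulFlattening_add,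
      koszulFlattening_sum p (Φy y) (Finset.univ.filter (fun l => ¬ ∀ k, a k = l → k ∈ Sset)),
      hzero, add_zero]
  have hrank_t' : (koszulFlattening p (Φy y) (∑ l ∈ Lset, triad (w l) (u l) (v l))).rank ≤
      (2 * p).choose p * Lset.card := by
    have h1 := LandsbergOttaviani2015_rank_koszulFlattening_le p (Φy y)
      (∑ l ∈ Lset, triad (w l) (u l) (v l))
    have h2 : tensorRank (∑ l ∈ Lset, triad (w l) (u l) (v l)) ≤ Lset.card := by
      have := tensorRank_le_card_of_eq_sum (t := ∑ l ∈ Lset, triad (w l) (u l) (v l))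
        (fun l : Lset => w l) (fun l => u l) (fun l => v l) (by rw [← Finset.sum_coe_sort])
      simpa using this
    exact h1.trans (Nat.mul_le_mul_left _ h2)
  have hLcard : Lset.card ≤ (tensorRank (matMulTensor ℂ n m n) - n ^ 2) + Sset.card := by
    have hsub : Lset ⊆ (Finset.univ \ Finset.univ.image a) ∪ Sset.image a := by
      intro l hl
      have hl' := (Finset.mem_filter.1 hl).2
      by_cases h : ∃ k, a k = l
      · obtain ⟨k, rfl⟩ := h
        exact Finset.mem_union_right _ (Finset.mem_image_of_mem a (hl' k rfl))
      · push Not at h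
        apply Finset.mem_union_left
        simp only [Finset.mem_sdiff, Finset.mem_univ, Finset.mem_image, true_and, not_exists]
        exact h
    have hcimg : (Finset.univ.image a : Finset (Fin (tensorRank (matMulTensor ℂ n m n)))).card =
        n ^ 2 := by
      rw [Finset.card_image_of_injective _ ha, Finset.card_univ, hcardκ]
    calc Lset.card ≤ ((Finset.univ \ Finset.univ.image a) ∪ Sset.image a).card :=
          Finset.card_le_card hsub
      _ ≤ (Finset.univ \ Finset.univ.image a).card + (Sset.image a).card :=
          Finset.card_union_le _ _
      _ = (tensorRank (matMulTensor ℂ n m n) - n ^ 2) + Sset.card := by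
          rw [Finset.card_univ_sdiff, hcimg, Fintype.card_fin,
            Finset.card_image_of_injective _ ha]
  -- combine
  have hfin : m * Fintype.card ι ≤
      (2 * p).choose p * ((tensorRank (matMulTensor ℂ n m n) - n ^ 2) + Fintype.card ι) := by
    refine hlow.trans ?_
    rw [hK]
    exact hrank_t'.trans (Nat.mul_le_mul_left _ (hLcard.trans (Nat.add_le_add_left hSι _)))
  have e : (tensorRank (matMulTensor ℂ n m n) - n ^ 2) + Fintype.card ι + n ^ 2 =
      Fintype.card ι + tensorRank (matMulTensor ℂ n m n) := by omega
  calc m * Fintype.card ι + (2 * p).choose p * n ^ 2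
      ≤ (2 * p).choose p * ((tensorRank (matMulTensor ℂ n m n) - n ^ 2) + Fintype.card ι) +
          (2 * p).choose p * n ^ 2 := Nat.add_le_add_right hfin _
    _ = (2 * p).choose p * (Fintype.card ι + tensorRank (matMulTensor ℂ n m n)) := by
        rw [← Nat.mul_add, e]

end PropTwoOne
/-! ## Landsberg 2014, Theorem 1.2 -/

/-- **Landsberg 2014, Theorem 1.2** (discharge of `Landsberg2014_thm_1_2`): over `ℂ`, for
`1 ≤ p ≤ n − 1`, `R(⟨n,n,n⟩) ≥ (3 − 1/(p+1)) n² − (1 + 2p binom(2p, p−1)) n`. From the mechanism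
`Landsberg2014_prop_2_1_koszul` and the non-degeneracy of `M̃` for `⟨p+1, ·, p+1⟩`
(`matMulKoszulMatrix_vandermondeProj_injective`): for `p ≥ 2` use the block-diagonal projection built
from `n/(p+1)` copies of the LO2015 projection (minor of size `ρ = (n − n mod (p+1)) binom(2p+1,p)`),
for `p = 1` the commutator projection of §4 (`ρ = 3n`); then `R ≥ n² + (n/binom(2p,p) − 1) ρ`, and
`binom(2p+1,p+1)(p+1) = (2p+1) binom(2p,p)`, `(p+1) binom(2p,p−1) = p binom(2p,p)`, `binom(2p,p) ≥ 2p`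
give the printed bound (for `n ≤ binom(2p,p)` it is below the flattening bound `n² ≤ R`). The error
term obtained this way is `≤ binom(2p+1,p) n ≤ (1 + 2p binom(2p,p−1)) n`; see the module docstring.
[cite: Landsberg2014, Thm 1.2 and §§3–4] -/
theorem Landsberg2014_thm_1_2_holds : Landsberg2014_thm_1_2 := by
  intro n p hp hpn
  have hsq : ((n : ℝ)) ^ 2 ≤ (tensorRank (matMulTensor ℂ n n n) : ℝ) := by
    exact_mod_cast matMulTensor_sq_le_tensorRank ℂ n
  have hn2 : 2 ≤ n := by omega
  have hn0 : (0 : ℝ) ≤ n := Nat.cast_nonneg n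
  rcases eq_or_lt_of_le hp with rfl | hp2
  · -- `p = 1`: the commutator projection, `ρ = 3n`
    obtain ⟨ε, hε⟩ := exists_det_submatrix_ne_zero_of_injective
      (matMulKoszulMatrix n 1 (commutatorProj ℂ n))
      (by simp [Fintype.card_prod])
      (matMulKoszulMatrix_commutatorProj_injective ℂ n hn2)
    have key := Landsberg2014_prop_2_1_koszul n n 1 (by omega) (commutatorProj ℂ n)
      (ι := PSub (2 * 1 + 1) (1 + 1) × Fin n) id ε (by simpa using hε)
    have hcard : Fintype.card (PSub (2 * 1 + 1) (1 + 1) × Fin n) = 3 * n := by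
      simp [Fintype.card_prod]
    have hc : (2 * 1).choose 1 = 2 := by decide
    rw [hcard, hc] at key
    have key' : (n : ℝ) * (3 * n) + 2 * (n : ℝ) ^ 2 ≤
        2 * (3 * n + (tensorRank (matMulTensor ℂ n n n) : ℝ)) := by
      exact_mod_cast key
    norm_num
    nlinarith [key']
  · -- `p ≥ 2`: blocks
    set r := tensorRank (matMulTensor ℂ n n n) with hr
    set C := (2 * p).choose p with hC
    have hC2p : 2 * p ≤ C := by
      have := Nat.choose_le_middle 1 (2 * p)
      rwa [Nat.choose_one_right, show 2 * p / 2 = p by omega] at this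
    have hCpos : 0 < C := by omega
    have hC' : (p + 1) * (2 * p).choose (p - 1) = p * C := by
      have := Nat.choose_succ_right_eq (2 * p) (p - 1)
      rw [show p - 1 + 1 = p by omega, show 2 * p - (p - 1) = p + 1 by omega] at this
      rw [mul_comm, ← this, mul_comm]
    have hD : (2 * p + 1).choose (p + 1) * (p + 1) = (2 * p + 1) * C := by
      exact (Nat.add_one_mul_choose_eq (2 * p) p).symm
    have hp1 : (0 : ℝ) < (p : ℝ) + 1 := by positivity
    have hp2r : (2 : ℝ) ≤ p := by exact_mod_cast hp2
    have hC2pr : 2 * (p : ℝ) ≤ C := by exact_mod_cast hC2p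
    have hC'r : ((p : ℝ) + 1) * ((2 * p).choose (p - 1) : ℝ) = p * C := by exact_mod_cast hC'
    have h3eq : ((p : ℝ) + 1) * ((3 - 1 / ((p : ℝ) + 1)) * (n : ℝ) ^ 2 -
        (1 + 2 * (p : ℝ) * ((2 * p).choose (p - 1) : ℝ)) * n) =
        (3 * p + 2) * (n : ℝ) ^ 2 - (p + 1) * n
          - 2 * p * (((p : ℝ) + 1) * ((2 * p).choose (p - 1) : ℝ)) * n := by
      field_simp
      ring
    rw [hC'r] at h3eq
    refine le_of_mul_le_mul_left ?_ hp1
    rw [h3eq]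
    by_cases hnC : n ≤ C
    · -- small `n`: the printed bound is at most `n² ≤ R`
      have h1 : (2 * p + 1) * n ≤ 2 * p ^ 2 * C :=
        calc (2 * p + 1) * n ≤ (2 * p + 1) * C := Nat.mul_le_mul_left _ hnC
          _ ≤ 2 * p ^ 2 * C := Nat.mul_le_mul_right _ (by nlinarith)
      have h1' : ((2 : ℝ) * p + 1) * n ≤ 2 * (p : ℝ) ^ 2 * C := by exact_mod_cast h1
      have h1'' := mul_le_mul_of_nonneg_right h1' hn0
      have hsq' := mul_le_mul_of_nonneg_left hsq (Nat.cast_nonneg p)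
      linarith [h1'', hsq, hsq', mul_nonneg (Nat.cast_nonneg p) hn0]
    · -- large `n`: block construction
      push Not at hnC
      set q := n / (p + 1) with hq
      set rem := n % (p + 1) with hrem'
      have hnq : n = (p + 1) * q + rem := (Nat.div_add_mod n (p + 1)).symm
      have hrem : rem ≤ p := Nat.lt_succ_iff.1 (Nat.mod_lt n (Nat.succ_pos p))
      obtain ⟨ε, hε⟩ := exists_det_submatrix_ne_zero_of_injective
        (matMulKoszulMatrix (p + 1) p (vandermondeProj ℂ p))
        (by simp [Fintype.card_prod, Nat.choose_symm_half])
        (matMulKoszulMatrix_vandermondeProj_injective ℂ p)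
      have hdet := det_blocks_ne_zero n p (vandermondeProj ℂ p) ε hε
      have key := Landsberg2014_prop_2_1_koszul n n p (by omega) (blockProj n p (vandermondeProj ℂ p))
        _ _ hdet
      have hcard : Fintype.card ((PSub (2 * p + 1) (p + 1) × Fin (p + 1)) × Fin (n / (p + 1))) =
          (2 * p + 1) * C * q := by
        rw [Fintype.card_prod, Fintype.card_prod, card_PSub, Fintype.card_fin, Fintype.card_fin,
          hD]
      rw [hcard] at key
      have keyr : (n : ℝ) * ((2 * p + 1) * C * q) + C * (n : ℝ) ^ 2 ≤
          C * ((2 * p + 1) * C * q + r) := by exact_mod_cast key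
      have hCr : (0 : ℝ) < C := by exact_mod_cast hCpos
      have h1 : (n : ℝ) ^ 2 + (2 * p + 1) * (n - C) * q ≤ r := by
        refine le_of_mul_le_mul_left ?_ hCr
        linarith [keyr]
      have hq' : ((p : ℝ) + 1) * q = n - rem := by
        have : (n : ℝ) = ((p : ℝ) + 1) * q + rem := by exact_mod_cast hnq
        linarith
      have hremr : (rem : ℝ) ≤ p := by exact_mod_cast hrem
      have hnCr : (C : ℝ) < n := by exact_mod_cast hnC
      have h2' : (2 * p + 1) * ((n : ℝ) - C) * (n - p) ≤ (p + 1) * ((2 * p + 1) * (n - C) * q) := by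
        have hnn : (0 : ℝ) ≤ (2 * p + 1) * (n - C) :=
          mul_nonneg (by positivity) (sub_nonneg.2 hnCr.le)
        calc (2 * p + 1) * ((n : ℝ) - C) * (n - p) ≤ (2 * p + 1) * (n - C) * (n - rem) :=
              mul_le_mul_of_nonneg_left (by linarith) hnn
          _ = (p + 1) * ((2 * p + 1) * (n - C) * q) := by rw [← hq']; ring
      have hcoef : (0 : ℝ) ≤ 1 - 2 * (p : ℝ) ^ 2 + (2 * (p : ℝ) ^ 2 - 2 * p - 1) * C := by
        have ht : (0 : ℝ) ≤ (p : ℝ) - 2 := sub_nonneg.2 hp2r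
        have hB : (0 : ℝ) ≤ 2 * (p : ℝ) ^ 2 - 2 * p - 1 := by linarith [mul_nonneg ht ht]
        have := mul_le_mul_of_nonneg_left hC2pr hB
        linarith [mul_nonneg (mul_nonneg ht ht) ht, mul_nonneg ht ht]
      have h3 : (3 * p + 2) * (n : ℝ) ^ 2 - (p + 1) * n - 2 * p * (p * C) * n ≤
          (p + 1) * (n : ℝ) ^ 2 + (2 * p + 1) * (n - C) * (n - p) := by
        linarith [mul_nonneg hcoef hn0, mul_nonneg (Nat.cast_nonneg p) hCr.le,
          mul_nonneg (mul_nonneg (Nat.cast_nonneg p) (Nat.cast_nonneg p)) hCr.le]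
      have h1p := mul_le_mul_of_nonneg_left h1 hp1.le
      linarith [h1p, h2', h3]

end Literature.Computability.AlgebraicComplexity

end
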